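import Summits.HodgeConjecture.HodgeConjecture.Cruxes.BlochSeedDiscOne.RingFiveEmpty

/-!
# BnCCert — the CERTIFICATE-CHECKER STATEMENT for floor ∕ depth certificates (ORDER D2, director-hodge g25 R19.434 ∕ R19.441 (4); dual lens g10)

Token: line stmt-HodgeConjecture-18881 Cruxes/BlochSeedDiscOne/Lines/birth.lean 814a6a70c14e831a stub_rung_pad4_seedAt.

HONEST FRAMING. This file TYPES a certificate format `BnCCert` (a branch-and-bound tree over CLASS statistics of the height-`h` letter
alphabet, flattened to its leaves, each leaf closed by an e-free (A1)-functional + cover ∕ parity multipliers in the manner of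
`RingFiveEmpty` (gs-eng-2 g59), plus LEVEL-0 «block laws» = the (A1).1 rotation-balance identities of `XBASE-DECIDED-dual-g10.md`
turned into PARITY facts), its checker `BnCCert.valid : BnCCert → Bool`, and the SOUNDNESS STATEMENT
`depthBound_of_valid : C.valid = true → DepthBound C.h C.B C.rmin (C.h − 1)` (= `FloorFree C.h C.B C.rmin` of `HeightTower`,
restated here by shape as `FloorFreeH` because `HeightTower`'s oleans are not on the farm yet, req-114; `floorFree_iff_depthBound` there).
SOUNDNESS STATUS (v7 = v6 + (E1c) UNIVERSE-RELATIVE CELL LEAVES `checkLeafOn` ∕ `leaf_core` ∕ `leafOn_sound` (§6: the pointwise check over an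
EXPLICIT cell list, certifying exactly the list-relative statement — the END-TO-END kernel replay of gs-eng-2's XBASE-LOCK leaf `rem`,
182 rows × 1 423 cells, runs through it; a list's justification is never part of a certificate); v6 = v5 + KERNEL-PRICE items; this file — NO `sorry`
ANYWHERE; v6∕v7 change NO statement and NO format field of v5: (P) the alphabets
`admP0 h` ∕ `admN0 h` go through LITERAL TABLES `admP0Table` ∕ `admN0Table` (`2 ≤ h ≤ 14`, verified ONCE against the definitions by
`admP0Table_ok` ∕ `admN0Table_ok`, `decide +kernel`; the kernel re-evaluated `admP0 h` — `|shapesAt h|²·64` ampleness tests — at EVERY use,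
which made a class leaf at `h = 6` cost > 25 min per side); (E1b, class level) the class-leaf pointwise check runs over SORTED types
`admTypesSorted` (one representative per slot permutation; transport = slot-permutation invariance of `admType` ∕ `Gtype` ∕ `coverPay` +
`RingFiveEmpty.forall_of_sorted4`, theorem `clsPt_all`) — measured: the degenerate class toy at `h = 6` (both sides, 2 × 495 sorted types)
elaborates in ≈ 20 s net (v5: P side 111 s for 6 561 ordered types, N side > 25 min), the parity toy and the cell toy at `h = 2` in ≈ 3 s net each.
PROVED: (S1) static admissibility `static_adm`, (S2) region cover `region_cover` (value vector `kOf`,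
cube completeness `mem_cube`, `IsMax` of the maximum, primary bounds, and the four DERIVED-bound rules re-proved sound:
cover-from-below ∕ cover-from-above via (A4) live partners + `belowB_of_ample`, union ∕ subset by counting) and (S5) the leaf Farkas step
`leaf_sound` (`Fval_vanishes` + summed pointwise checks + attained ∕ even masses + closing inequality) are PROVED, sorry-free, for BOTH
leaf functionals — CLASS (`Func.cls γ`, `RingFiveEmpty.G_vanishes`) and, since v3 = EXTENSION E1 (R19.454 (2)), CELL (`Func.cell rows`:
integer combinations of real ∕ imaginary parts of arbitrary (A1) rows — mixed words `T w = 0` and e-free differences `T w = T w'` — checked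
on every admissible CELL; `row_balance` = (A1) via `DepthBoundA4.T_eq_linG`, `Gc_balance`, and the COMPLETENESS of the cell enumeration
`mem_admCells`: every cell whose type is admissible in the region is a letter filling of an enumerated type, so no cell list and no anchor
list is part of a certificate and nothing about coverage is trusted), and — since v4 — (S3) BLOCK-LAW SOUNDNESS `law_sound` (§4b: a LEVEL-0
block law, VERIFIED NUMERICALLY by `checkLaw` on every admissible type, gives the vanishing `β̄`-sum `Σ_{U_N} m·β̄ − Σ_{U_P} m·β̄ = 0` in `ℤ[i]`
as the `y`-combination of the 27 (A1).1 rows «`e` at the active slot, e-free filling elsewhere» (`lawWord`, `cellCoef_lawWord`, `lawG_balance`,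
hub-active cells drop out by `β = 0`, then cancel `K ≠ 0` in the domain `ℤ[i]`); no law GENERATOR enters the kernel), and — since v5 —
(S4) PARITY EXTRACTION `parity_even` (§4c: the real and imaginary parts of the (S3) identity feed the pure-ℤ `parity_core` — integer weights on
Gaussian integers of ONE common valuation `v₂(x² + y²)` (the `val2` conjunct of `checkLaw`, `twoVal_spec`, `val2_spec`) with vanishing weighted
`x`- and `y`-sums have EVEN total weight, by «halving» induction `(x, y) ↦ ((x+y)/2, (y−x)/2)` — then the Bool-XOR parity `xor_parity` of
`checkParity`'s fold and linearity of `linZ`).  HENCE `depthBound_of_valid : C.valid = true → DepthBound C.h C.B C.rmin (C.h − 1)` and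
`floorFree_of_valid` (§7) are THEOREMS WITH NO `sorry` in their dependency cone, for every certificate of the frozen grammar (class leaves,
cell leaves, parity records): ORDER D2 is kernel-complete for FORMAT v1 + "func".  (History: parity records enter
`depthBound_of_valid` only through records with `thr = 2`; before v5
`depthBound_of_valid_parityFree : C.valid = true → C.parityFree = true → DepthBound C.h C.B C.rmin (C.h − 1)` was the sorry-free
fragment (v2–v4); it is kept.  Axioms of `depthBound_of_valid` ∕ `floorFree_of_valid`: `propext`, `Classical.choice`, `Quot.sound` (checked).)
Every certificate — class leaves, cell leaves, parity records — that the checker accepts is a kernel proof of floor-freeness.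
The checker EVALUATES IN THE KERNEL: (i) a degenerate CLASS toy (`h = 6, B = 0, rmin = 1`, one leaf, `γ = 0, L = ρ = 1`) is `valid = true` by
`decide +kernel` in a scratch copy (v6: ≈ 20 s net, 2 × 495 SORTED admissible types; v0: ≈ 2 min over 2 × 6 561 ordered types, v5: > 25 min —
see (P) above) giving a closed sorry-free proof of `DepthBound 6 0 1 5`; (i′) a PARITY toy (`h = 2`: one block law `y = e_{(1,1,1)}`, `K = 1`, one
record `thr = 2` justified by it, zero functional, `L = 1, ρ = 0`) is `valid = true` by `decide +kernel` (≈ 3 s net) giving `DepthBound 2 0 1 1`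
through the FULL theorem (parity layer load-bearing: `parityFree = false`); (ii) a CELL toy (`h = 2, B = 0, rmin = 1`, one leaf with the mixed row `e111` and the e-free difference `hhpp − 1ppp`,
`λre = 1` each, `L = 12, ρ = 1`; 256 admissible P-cells + 1 N-cell) is `valid = true` by `decide +kernel` in 13 s (whole file) giving a closed
sorry-free proof of `DepthBound 2 0 1 1` (axioms as above).  The cell arithmetic runs on integer pairs `(re, im)` (`coefP ∕ mulP ∕ cellCoefP`,
proved equal to `DepthBoundA4.cellCoef` by `cellCoefP_eq`) — `ℤ[i]` instance arithmetic does not reduce in the kernel in useful time.  COST of a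
cell leaf = (number of admissible cells of its region) × (rows); a full-alphabet region at `h = 6` has ≈ 10⁷ cells per side, so cell leaves
are for SMALL regions only (XBASE-LOCK: 1 423 cells) — exactly R19.441's «only where a class leaf does not close».  The toys are NOT in
this file and prove nothing of interest.
NO certificate for `FloorFree 6 199 8` exists yet (ORDER P, gs-eng-2 g60∕61, is the pilot that would produce leaves; THEOREM X of the
XBASE memo is ONE region of such a tree, decided ×2 on the bus, not in the kernel). Letter designs ≠ designs-with-sheaves ≠ a SEED;
nothing here is proved toward HC ∕ HC_CM ∕ HC_AV ∕ №4 ∕ 26512 ∕ 18881 ∕ H2. No `axiom` ∕ `instance` ∕ `native_decide` ∕ notation;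
NO `sorry`.

## FORMAT v1 (v0 proposed l.10921, steered R19.441, delivered l.11003; v1 = per-variable records; frozen after gs-eng-2's PREREG answer — one exchange)

Data model = `DepthBoundA4` (letters `(a; x, y)`, cells `Fin 4 → Letter`, designs `N − P` with multiplicities, `A1`, `A4`, `mu`, `copies`,
`rank`).  A letter's SHAPE is `(a; p, q)`, `p = max(|x|,|y|) ≥ q = min(|x|,|y|)`; e-free class data `(a, n = a² − p² − q²)` depend on the
shape only; the shapes of the height-`h` alphabet are `shapesAt h` (at `h = 6`: 16 shapes; `admP0 6` = the 9 off-axis shapes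
`(0;5,1) (0;4,2) (0;3,3) (1;4,1) (1;3,2) (2;3,1) (2;2,2) (3;2,1) (4;1,1)`, `admN0 6` = the 9 shapes with `a ≥ 2` and `p + q = 6 − a`, floor shapes
`(0;5,1) (0;4,2) (0;3,3)` — `decide`d in a scratch copy, not asserted in this file).
* STATISTIC (`Stat`) = a finite set of shapes; its value on a cell = the number of slots whose letter has a shape in the set (∈ {0,…,4}).
* BRANCH VARIABLE (`Var`) = (side ∈ {N, P}, statistic); its VALUE on a design = the maximum of the statistic over the supported cells of
  that side.  Variable 0 is `(P, floor shapes)`; the certificate refutes every design on which it is `≥ 1` (a floor letter `a = 0` can only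
  sit in a P-cell: nothing is amply below it).  A design determines the value vector `K ∈ {0..4}^vars`; `valid` demands that every vector
  with `K₀ ≥ 1` is matched by some LEAF (`caps`, `none` = free) — the B&B tree flattened (JSON `node:{branch…, children}` ↦ leaves).
* LEAF = one RECORD per variable (`VarRec`: `cap` (`none` = free), multiplier `Y ≥ 0` paying for the mass `≥ thr` on the cells ATTAINING
  the cap, `thr ∈ {0,1,2}` — `1`: an attained maximum; `2`: attained AND even by a PARITY certificate `par` = law indices) + DERIVED bounds
  (rules: cover-from-below, cover-from-above, union, subset — each re-checked) + a FUNCTIONAL `func : Func` — CLASS: an e-free functional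
  `γ : RingFiveEmpty.Coefs` (multipliers of the six `S₄`-symmetrised (A1).2 rows `ρ₂ … ρ₆` = the memo's DegRow₁…₆ up to basis), or CELL (E1, v3):
  a list of (A1) rows `RowSpec = (w, w2, λre, λim)` — `w2 = null`: the mixed word `w` (`T w = 0`); `w2 = w'`: the e-free difference (`T w = T w'`)
  — with integer multipliers of their real and imaginary parts; a bound `L ≥ 0`, a rank multiplier `ρ ≥ 0`, the block laws, and the closing
  inequality `Σ_i Y_i·thr_i + ρ·rmin > L·B`.  Checks (all `Bool`; class: by enumeration of the ordered shape 4-tuples admissible in the region;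
  cell: by enumeration of their letter fillings = the admissible CELLS, `F` = the cell functional `Gc`):
  N side `F + Σ_{i on N} Y_i·[count_i = K_i] ≤ L − ρ`, P side `−F + Σ_{i on P} Y_i·[count_i = K_i] ≤ L + ρ`.
  Soundness: `0 = Σ_N m F − Σ_P m F` (`Fval_vanishes`: `G_vanishes` ∕ `Gc_balance`) `≤ L·M − ρ·rank − Σ Y_i·mass(attaining_i) ≤ L·B − ρ·rmin − Σ Y_i thr_i < 0`.
* LEVEL 0 BLOCK LAW (`Law`) = (active slot `f`, 27 integers `y_φ` over the e-free fillings `φ ∈ {1,h,pt}³` of the passive slots, a constant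
  `K ≠ 0`, a target set of passive shape-triples).  Valid in a region iff `Σ_φ y_φ·Π_j v(τ_j)[φ_j] = K·[τ ∈ targ]` for the passive triple
  `τ` of EVERY admissible ordered 4-tuple (either side) whose active shape is not the hub (`v(σ) = (1, a, n)`), and all active shapes over
  the law's set `U = {admissible t : passive(t) ∈ targ, active non-hub}` have the same 2-adic valuation of `p² + q²`.  Then the (A1).1 rows
  «`e` at `f`, `φ` elsewhere» give `Σ_{c ∈ U} ± m_c·β̄(c_f) = 0` in `ℤ[i]`, hence (common `(1+i)`-adic valuation, unit parts `≡ 1 mod (1+i)`)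
  the total mass of `U` is EVEN.  A PARITY entry `(i, [j₁,…])` certifies that the attaining set of variable `i` is the pointwise XOR of the
  `U`-sets of laws `j₁,…` (so its mass is even; with `≥ 1` it is `≥ 2`).  THEOREM X's LAW M is the instance `f = 0`, `targ = {(m,m,m)}`,
  `K = 1728`, 23 non-zero `y_φ`, region = XBASE.
* JSON (gs-eng-2 ∕ `shcheck.py` alignment): `{"h","B","rmin","vars":[{"side":"P|N","shapes":[[a,p,q],…]}],"leaves":[{"recs":[{"cap":k|null,
  "Y","thr","par":[j,…]},… one per var],"derived":[{"side","shapes","cap","rule":"below|above|union|subset","src":[i,j]}],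
  "func": {"kind":"class","gamma":[g2,g3,g4,g5,g6,g7]} | {"kind":"cell","rows":[{"w":"e1hp","w2":null|"hhpp","lre":int,"lim":int},…]},
  "L","rho","laws":[{"slot":f,"y":[27 ints, (1,h,pt)³ lexicographic in increasing passive-slot order],"K","targ":[[[a,p,q]×3],…]}]}]}` —
  words = 4 letters over `1 h e E p` in slot order (`E = ē`, `p = pt`; s4-search-1 ∕ gs-eng-2's keys «e1hp:re» ↦ `{"w":"e1hp",…,"lre":λ}`, «:im» ↦
  `"lim"`, e-free keys «efree:d:k» ↦ an explicit pair `{"w":…,"w2":…}` of that degree); rationals cleared to integers LEAF BY LEAF (multiply the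
  LP dual by the leaf's common denominator; `L`, `Y`, `ρ`, `γ`, `λ` all integers, exactly as `RingFiveEmpty`'s certificates).  Not typed: orbit
  folding of cell leaves under the node's symmetry group (`grp = G12288` of `B4FloorSymmetry`; v3 = `grp none`, every cell enumerated) = E1b;
  the `μ`-branch of `RingFiveEmpty` (`QP0 ∕ QN0`) = E2; sorted-tuple enumeration of CLASS leaves = E3 — DONE in v6 as E1b-class (`admTypesSorted`, factor `m⁴ ∕ C(m+3,4) → 24`:
13.3× at `h = 6`, 21.3× at `h = 14`); laws ∕ parity certificates ∕ cell leaves keep the ordered enumerations (slot-specific).  LEAF-orbit folding is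
vacuous in FORMAT v1: every region is `G`-stable (variables are slot-symmetric counts of rotation∕conjugation-blind shapes), so the group acts
INSIDE a leaf, on the pointwise domain — folded at class level here; at cell level (phase sectors, factor `4^{#non-hub slots} ≤ 256`, rows of
trivial character) it is E1b-cell, not typed.
-/

set_option linter.dupNamespace false
set_option autoImplicit false

namespace Summit.HodgeConjecture.HodgeConjecture.Cruxes.BlochSeedDiscOne.BnCCert

open Summit.HodgeConjecture.HodgeConjecture.Cruxes.BlochSeedDiscOne.DepthBoundA4
open Summit.HodgeConjecture.HodgeConjecture.Cruxes.BlochSeedDiscOne.RingFiveEmpty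

/-! ## §1 Shapes of letters and the height-`h` shape alphabet -/

/-- The shape `(a; p, q)` of a letter: level `a`, `p = max(|x|,|y|)`, `q = min(|x|,|y|)`. -/
structure Shape where
  a : ℤ
  p : ℤ
  q : ℤ
deriving DecidableEq, Repr

/-- shape of a letter -/
def shapeOf (ℓ : Letter) : Shape := ⟨ℓ.a, max |ℓ.x| |ℓ.y|, min |ℓ.x| |ℓ.y|⟩

namespace Shape

/-- `|β|² = p² + q²` -/
def bnorm (σ : Shape) : ℤ := σ.p ^ 2 + σ.q ^ 2
/-- the `pt`-coefficient `n = a² − |β|²` -/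
def n (σ : Shape) : ℤ := σ.a ^ 2 - σ.bnorm
/-- the hub shape `(h; 0, 0)` (`β = 0`) -/
def isHub (σ : Shape) : Bool := decide (σ.p = 0 ∧ σ.q = 0)
/-- off-axis (`x·y ≠ 0`, i.e. `q ≥ 1`) — P-letters are off-axis (`DepthBoundA4.no_ample_cover_of_axis`) -/
def offAxis (σ : Shape) : Bool := decide (0 < σ.q)
/-- floor shape: level `a = 0` (co-level `h`, the deepest ring) -/
def isFloor (σ : Shape) : Bool := decide (σ.a = 0)
/-- the letters of a shape (4 or 8 of them, 1 for the hub) -/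
def letters (σ : Shape) : List Letter :=
  ([(σ.p, σ.q), (σ.q, σ.p), (-σ.p, σ.q), (σ.q, -σ.p), (σ.p, -σ.q), (-σ.q, σ.p), (-σ.p, -σ.q), (-σ.q, -σ.p)].dedup).map
    fun xy => (⟨σ.a, xy.1, xy.2⟩ : Letter)

end Shape

/-- The shapes of the height-`h` alphabet: `a ≥ 0`, `p ≥ q ≥ 0`, `a + p + q = h`. -/
def shapesAt (h : ℕ) : List Shape :=
  (List.range (h + 1)).flatMap fun a => (List.range (h + 1)).filterMap fun q =>
    if 2 * q + a ≤ h then some ⟨(a : ℤ), ((h - a - q : ℕ) : ℤ), (q : ℤ)⟩ else none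

/-- `AmpleAbove lo hi` as a `Bool`. -/
def ampleB (lo hi : Letter) : Bool :=
  decide (lo.a < hi.a) && decide ((hi.x - lo.x) ^ 2 + (hi.y - lo.y) ^ 2 < (hi.a - lo.a) ^ 2)

theorem ampleB_iff (lo hi : Letter) : ampleB lo hi = true ↔ AmpleAbove lo hi := by
  simp [ampleB, AmpleAbove]

/-- some letter of shape `τ` lies amply below some letter of shape `σ` -/
def belowB (τ σ : Shape) : Bool := τ.letters.any fun lo => σ.letters.any fun hi => ampleB lo hi

/-- statically admissible P-shapes at height `h`: off-axis and amply below some letter of the alphabet ((A4), P side) -/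
def admP0 (h : ℕ) : List Shape := (shapesAt h).filter fun τ => τ.offAxis && (shapesAt h).any fun σ => belowB τ σ
/-- statically admissible N-shapes: amply above some admissible P-shape ((A4), N side; in particular `a ≥ 1`) -/
def admN0 (h : ℕ) : List Shape := (shapesAt h).filter fun σ => (admP0 h).any fun τ => belowB τ σ

/-- association-list lookup (structural; kernel-cheap) -/
def lookupT : List (ℕ × List Shape) → ℕ → Option (List Shape)
  | [], _ => none
  | (k, l) :: rest, h => if k = h then some l else lookupT rest h

theorem lookupT_sound {tbl : List (ℕ × List Shape)} {h : ℕ} {l : List Shape} (hl : lookupT tbl h = some l) : (h, l) ∈ tbl := by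
  induction tbl with
  | nil => simp [lookupT] at hl
  | cons e rest ih =>
    obtain ⟨k, l'⟩ := e
    by_cases hk : k = h
    · simp only [lookupT, hk, if_true, Option.some.injEq] at hl
      subst hl; subst hk; exact List.mem_cons_self
    · simp only [lookupT, hk, if_false] at hl
      exact List.mem_cons_of_mem _ (ih hl)

/-- LITERAL TABLE of `admP0 h`, `2 ≤ h ≤ 14` (kernel replay: `admP0 h` costs `|shapesAt h|²·64` ampleness tests per evaluation and the
kernel re-evaluates it at EVERY use — per slot per type; the table makes it a lookup). Verified against the definition ONCE: `admP0Table_ok`. -/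
def admP0Table : List (ℕ × List Shape) :=
  [(2, [⟨0, 1, 1⟩]),
   (3, [⟨0, 2, 1⟩, ⟨1, 1, 1⟩]),
   (4, [⟨0, 3, 1⟩, ⟨0, 2, 2⟩, ⟨1, 2, 1⟩, ⟨2, 1, 1⟩]),
   (5, [⟨0, 4, 1⟩, ⟨0, 3, 2⟩, ⟨1, 3, 1⟩, ⟨1, 2, 2⟩, ⟨2, 2, 1⟩, ⟨3, 1, 1⟩]),
   (6, [⟨0, 5, 1⟩, ⟨0, 4, 2⟩, ⟨0, 3, 3⟩, ⟨1, 4, 1⟩, ⟨1, 3, 2⟩, ⟨2, 3, 1⟩, ⟨2, 2, 2⟩, ⟨3, 2, 1⟩, ⟨4, 1, 1⟩]),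
   (7, [⟨0, 6, 1⟩, ⟨0, 5, 2⟩, ⟨0, 4, 3⟩, ⟨1, 5, 1⟩, ⟨1, 4, 2⟩, ⟨1, 3, 3⟩, ⟨2, 4, 1⟩, ⟨2, 3, 2⟩, ⟨3, 3, 1⟩, ⟨3, 2, 2⟩, ⟨4, 2, 1⟩, ⟨5, 1, 1⟩]),
   (8, [⟨0, 7, 1⟩, ⟨0, 6, 2⟩, ⟨0, 5, 3⟩, ⟨0, 4, 4⟩, ⟨1, 6, 1⟩, ⟨1, 5, 2⟩, ⟨1, 4, 3⟩, ⟨2, 5, 1⟩, ⟨2, 4, 2⟩, ⟨2, 3, 3⟩, ⟨3, 4, 1⟩, ⟨3, 3, 2⟩, ⟨4, 3, 1⟩, ⟨4, 2, 2⟩, ⟨5, 2, 1⟩, ⟨6, 1, 1⟩]),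
   (9, [⟨0, 8, 1⟩, ⟨0, 7, 2⟩, ⟨0, 6, 3⟩, ⟨0, 5, 4⟩, ⟨1, 7, 1⟩, ⟨1, 6, 2⟩, ⟨1, 5, 3⟩, ⟨1, 4, 4⟩, ⟨2, 6, 1⟩, ⟨2, 5, 2⟩, ⟨2, 4, 3⟩, ⟨3, 5, 1⟩, ⟨3, 4, 2⟩, ⟨3, 3, 3⟩, ⟨4, 4, 1⟩, ⟨4, 3, 2⟩, ⟨5, 3, 1⟩, ⟨5, 2, 2⟩, ⟨6, 2, 1⟩, ⟨7, 1, 1⟩]),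
   (10, [⟨0, 9, 1⟩, ⟨0, 8, 2⟩, ⟨0, 7, 3⟩, ⟨0, 6, 4⟩, ⟨0, 5, 5⟩, ⟨1, 8, 1⟩, ⟨1, 7, 2⟩, ⟨1, 6, 3⟩, ⟨1, 5, 4⟩, ⟨2, 7, 1⟩, ⟨2, 6, 2⟩, ⟨2, 5, 3⟩, ⟨2, 4, 4⟩, ⟨3, 6, 1⟩, ⟨3, 5, 2⟩, ⟨3, 4, 3⟩, ⟨4, 5, 1⟩, ⟨4, 4, 2⟩, ⟨4, 3, 3⟩, ⟨5, 4, 1⟩, ⟨5, 3, 2⟩, ⟨6, 3, 1⟩, ⟨6, 2, 2⟩, ⟨7, 2, 1⟩, ⟨8, 1, 1⟩]),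
   (11, [⟨0, 10, 1⟩, ⟨0, 9, 2⟩, ⟨0, 8, 3⟩, ⟨0, 7, 4⟩, ⟨0, 6, 5⟩, ⟨1, 9, 1⟩, ⟨1, 8, 2⟩, ⟨1, 7, 3⟩, ⟨1, 6, 4⟩, ⟨1, 5, 5⟩, ⟨2, 8, 1⟩, ⟨2, 7, 2⟩, ⟨2, 6, 3⟩, ⟨2, 5, 4⟩, ⟨3, 7, 1⟩, ⟨3, 6, 2⟩, ⟨3, 5, 3⟩, ⟨3, 4, 4⟩, ⟨4, 6, 1⟩, ⟨4, 5, 2⟩, ⟨4, 4, 3⟩, ⟨5, 5, 1⟩, ⟨5, 4, 2⟩, ⟨5, 3, 3⟩, ⟨6, 4, 1⟩, ⟨6, 3, 2⟩, ⟨7, 3, 1⟩, ⟨7, 2, 2⟩, ⟨8, 2, 1⟩, ⟨9, 1, 1⟩]),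
   (12, [⟨0, 11, 1⟩, ⟨0, 10, 2⟩, ⟨0, 9, 3⟩, ⟨0, 8, 4⟩, ⟨0, 7, 5⟩, ⟨0, 6, 6⟩, ⟨1, 10, 1⟩, ⟨1, 9, 2⟩, ⟨1, 8, 3⟩, ⟨1, 7, 4⟩, ⟨1, 6, 5⟩, ⟨2, 9, 1⟩, ⟨2, 8, 2⟩, ⟨2, 7, 3⟩, ⟨2, 6, 4⟩, ⟨2, 5, 5⟩, ⟨3, 8, 1⟩, ⟨3, 7, 2⟩, ⟨3, 6, 3⟩, ⟨3, 5, 4⟩, ⟨4, 7, 1⟩, ⟨4, 6, 2⟩, ⟨4, 5, 3⟩, ⟨4, 4, 4⟩, ⟨5, 6, 1⟩, ⟨5, 5, 2⟩, ⟨5, 4, 3⟩, ⟨6, 5, 1⟩, ⟨6, 4, 2⟩, ⟨6, 3, 3⟩, ⟨7, 4, 1⟩, ⟨7, 3, 2⟩, ⟨8, 3, 1⟩, ⟨8, 2, 2⟩, ⟨9, 2, 1⟩, ⟨10, 1, 1⟩]),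
   (13, [⟨0, 12, 1⟩, ⟨0, 11, 2⟩, ⟨0, 10, 3⟩, ⟨0, 9, 4⟩, ⟨0, 8, 5⟩, ⟨0, 7, 6⟩, ⟨1, 11, 1⟩, ⟨1, 10, 2⟩, ⟨1, 9, 3⟩, ⟨1, 8, 4⟩, ⟨1, 7, 5⟩, ⟨1, 6, 6⟩, ⟨2, 10, 1⟩, ⟨2, 9, 2⟩, ⟨2, 8, 3⟩, ⟨2, 7, 4⟩, ⟨2, 6, 5⟩, ⟨3, 9, 1⟩, ⟨3, 8, 2⟩, ⟨3, 7, 3⟩, ⟨3, 6, 4⟩, ⟨3, 5, 5⟩, ⟨4, 8, 1⟩, ⟨4, 7, 2⟩, ⟨4, 6, 3⟩, ⟨4, 5, 4⟩, ⟨5, 7, 1⟩, ⟨5, 6, 2⟩, ⟨5, 5, 3⟩, ⟨5, 4, 4⟩, ⟨6, 6, 1⟩, ⟨6, 5, 2⟩, ⟨6, 4, 3⟩, ⟨7, 5, 1⟩, ⟨7, 4, 2⟩, ⟨7, 3, 3⟩, ⟨8, 4, 1⟩, ⟨8, 3, 2⟩, ⟨9, 3, 1⟩, ⟨9, 2, 2⟩,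 ⟨10, 2, 1⟩, ⟨11, 1, 1⟩]),
   (14, [⟨0, 13, 1⟩, ⟨0, 12, 2⟩, ⟨0, 11, 3⟩, ⟨0, 10, 4⟩, ⟨0, 9, 5⟩, ⟨0, 8, 6⟩, ⟨0, 7, 7⟩, ⟨1, 12, 1⟩, ⟨1, 11, 2⟩, ⟨1, 10, 3⟩, ⟨1, 9, 4⟩, ⟨1, 8, 5⟩, ⟨1, 7, 6⟩, ⟨2, 11, 1⟩, ⟨2, 10, 2⟩, ⟨2, 9, 3⟩, ⟨2, 8, 4⟩, ⟨2, 7, 5⟩, ⟨2, 6, 6⟩, ⟨3, 10, 1⟩, ⟨3, 9, 2⟩, ⟨3, 8, 3⟩, ⟨3, 7, 4⟩, ⟨3, 6, 5⟩, ⟨4, 9, 1⟩, ⟨4, 8, 2⟩, ⟨4, 7, 3⟩, ⟨4, 6, 4⟩, ⟨4, 5, 5⟩, ⟨5, 8, 1⟩, ⟨5, 7, 2⟩, ⟨5, 6, 3⟩, ⟨5, 5, 4⟩, ⟨6, 7, 1⟩, ⟨6, 6, 2⟩, ⟨6, 5, 3⟩, ⟨6, 4, 4⟩, ⟨7, 6,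 1⟩, ⟨7, 5, 2⟩, ⟨7, 4, 3⟩, ⟨8, 5, 1⟩, ⟨8, 4, 2⟩, ⟨8, 3, 3⟩, ⟨9, 4, 1⟩, ⟨9, 3, 2⟩, ⟨10, 3, 1⟩, ⟨10, 2, 2⟩, ⟨11, 2, 1⟩, ⟨12, 1, 1⟩])]

/-- LITERAL TABLE of `admN0 h`, `2 ≤ h ≤ 14` (see `admP0Table`); verified ONCE: `admN0Table_ok`. -/
def admN0Table : List (ℕ × List Shape) :=
  [(2, [⟨2, 0, 0⟩]),
   (3, [⟨2, 1, 0⟩, ⟨3, 0, 0⟩]),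
   (4, [⟨2, 2, 0⟩, ⟨2, 1, 1⟩, ⟨3, 1, 0⟩, ⟨4, 0, 0⟩]),
   (5, [⟨2, 3, 0⟩, ⟨2, 2, 1⟩, ⟨3, 2, 0⟩, ⟨3, 1, 1⟩, ⟨4, 1, 0⟩, ⟨5, 0, 0⟩]),
   (6, [⟨2, 4, 0⟩, ⟨2, 3, 1⟩, ⟨2, 2, 2⟩, ⟨3, 3, 0⟩, ⟨3, 2, 1⟩, ⟨4, 2, 0⟩, ⟨4, 1, 1⟩, ⟨5, 1, 0⟩, ⟨6, 0, 0⟩]),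
   (7, [⟨2, 5, 0⟩, ⟨2, 4, 1⟩, ⟨2, 3, 2⟩, ⟨3, 4, 0⟩, ⟨3, 3, 1⟩, ⟨3, 2, 2⟩, ⟨4, 3, 0⟩, ⟨4, 2, 1⟩, ⟨5, 2, 0⟩, ⟨5, 1, 1⟩, ⟨6, 1, 0⟩, ⟨7, 0, 0⟩]),
   (8, [⟨2, 6, 0⟩, ⟨2, 5, 1⟩, ⟨2, 4, 2⟩, ⟨2, 3, 3⟩, ⟨3, 5, 0⟩, ⟨3, 4, 1⟩, ⟨3, 3, 2⟩, ⟨4, 4, 0⟩, ⟨4, 3, 1⟩, ⟨4, 2, 2⟩, ⟨5, 3, 0⟩, ⟨5, 2, 1⟩, ⟨6, 2, 0⟩, ⟨6, 1, 1⟩, ⟨7, 1, 0⟩, ⟨8, 0, 0⟩]),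
   (9, [⟨2, 7, 0⟩, ⟨2, 6, 1⟩, ⟨2, 5, 2⟩, ⟨2, 4, 3⟩, ⟨3, 6, 0⟩, ⟨3, 5, 1⟩, ⟨3, 4, 2⟩, ⟨3, 3, 3⟩, ⟨4, 5, 0⟩, ⟨4, 4, 1⟩, ⟨4, 3, 2⟩, ⟨5, 4, 0⟩, ⟨5, 3, 1⟩, ⟨5, 2, 2⟩, ⟨6, 3, 0⟩, ⟨6, 2, 1⟩, ⟨7, 2, 0⟩, ⟨7, 1, 1⟩, ⟨8, 1, 0⟩, ⟨9, 0, 0⟩]),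
   (10, [⟨2, 8, 0⟩, ⟨2, 7, 1⟩, ⟨2, 6, 2⟩, ⟨2, 5, 3⟩, ⟨2, 4, 4⟩, ⟨3, 7, 0⟩, ⟨3, 6, 1⟩, ⟨3, 5, 2⟩, ⟨3, 4, 3⟩, ⟨4, 6, 0⟩, ⟨4, 5, 1⟩, ⟨4, 4, 2⟩, ⟨4, 3, 3⟩, ⟨5, 5, 0⟩, ⟨5, 4, 1⟩, ⟨5, 3, 2⟩, ⟨6, 4, 0⟩, ⟨6, 3, 1⟩, ⟨6, 2, 2⟩, ⟨7, 3, 0⟩, ⟨7, 2, 1⟩, ⟨8, 2, 0⟩, ⟨8, 1, 1⟩, ⟨9, 1, 0⟩, ⟨10, 0, 0⟩]),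
   (11, [⟨2, 9, 0⟩, ⟨2, 8, 1⟩, ⟨2, 7, 2⟩, ⟨2, 6, 3⟩, ⟨2, 5, 4⟩, ⟨3, 8, 0⟩, ⟨3, 7, 1⟩, ⟨3, 6, 2⟩, ⟨3, 5, 3⟩, ⟨3, 4, 4⟩, ⟨4, 7, 0⟩, ⟨4, 6, 1⟩, ⟨4, 5, 2⟩, ⟨4, 4, 3⟩, ⟨5, 6, 0⟩, ⟨5, 5, 1⟩, ⟨5, 4, 2⟩, ⟨5, 3, 3⟩, ⟨6, 5, 0⟩, ⟨6, 4, 1⟩, ⟨6, 3, 2⟩, ⟨7, 4, 0⟩, ⟨7, 3, 1⟩, ⟨7, 2, 2⟩, ⟨8, 3, 0⟩, ⟨8, 2, 1⟩, ⟨9, 2, 0⟩, ⟨9, 1, 1⟩, ⟨10, 1, 0⟩, ⟨11, 0, 0⟩]),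
   (12, [⟨2, 10, 0⟩, ⟨2, 9, 1⟩, ⟨2, 8, 2⟩, ⟨2, 7, 3⟩, ⟨2, 6, 4⟩, ⟨2, 5, 5⟩, ⟨3, 9, 0⟩, ⟨3, 8, 1⟩, ⟨3, 7, 2⟩, ⟨3, 6, 3⟩, ⟨3, 5, 4⟩, ⟨4, 8, 0⟩, ⟨4, 7, 1⟩, ⟨4, 6, 2⟩, ⟨4, 5, 3⟩, ⟨4, 4, 4⟩, ⟨5, 7, 0⟩, ⟨5, 6, 1⟩, ⟨5, 5, 2⟩, ⟨5, 4, 3⟩, ⟨6, 6, 0⟩, ⟨6, 5, 1⟩, ⟨6, 4, 2⟩, ⟨6, 3, 3⟩, ⟨7, 5, 0⟩, ⟨7, 4, 1⟩, ⟨7, 3, 2⟩, ⟨8, 4, 0⟩, ⟨8, 3, 1⟩, ⟨8, 2, 2⟩, ⟨9, 3, 0⟩, ⟨9, 2, 1⟩, ⟨10, 2, 0⟩, ⟨10, 1, 1⟩, ⟨11, 1, 0⟩, ⟨12, 0, 0⟩]),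
   (13, [⟨2, 11, 0⟩, ⟨2, 10, 1⟩, ⟨2, 9, 2⟩, ⟨2, 8, 3⟩, ⟨2, 7, 4⟩, ⟨2, 6, 5⟩, ⟨3, 10, 0⟩, ⟨3, 9, 1⟩, ⟨3, 8, 2⟩, ⟨3, 7, 3⟩, ⟨3, 6, 4⟩, ⟨3, 5, 5⟩, ⟨4, 9, 0⟩, ⟨4, 8, 1⟩, ⟨4, 7, 2⟩, ⟨4, 6, 3⟩, ⟨4, 5, 4⟩, ⟨5, 8, 0⟩, ⟨5, 7, 1⟩, ⟨5, 6, 2⟩, ⟨5, 5, 3⟩, ⟨5, 4, 4⟩, ⟨6, 7, 0⟩, ⟨6, 6, 1⟩, ⟨6, 5, 2⟩, ⟨6, 4, 3⟩, ⟨7, 6, 0⟩, ⟨7, 5, 1⟩, ⟨7, 4, 2⟩, ⟨7, 3, 3⟩, ⟨8, 5, 0⟩, ⟨8, 4, 1⟩, ⟨8, 3, 2⟩, ⟨9, 4, 0⟩, ⟨9, 3, 1⟩, ⟨9, 2, 2⟩, ⟨10, 3, 0⟩, ⟨10, 2, 1⟩, ⟨11, 2, 0⟩, ⟨11, 1, 1⟩,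 ⟨12, 1, 0⟩, ⟨13, 0, 0⟩]),
   (14, [⟨2, 12, 0⟩, ⟨2, 11, 1⟩, ⟨2, 10, 2⟩, ⟨2, 9, 3⟩, ⟨2, 8, 4⟩, ⟨2, 7, 5⟩, ⟨2, 6, 6⟩, ⟨3, 11, 0⟩, ⟨3, 10, 1⟩, ⟨3, 9, 2⟩, ⟨3, 8, 3⟩, ⟨3, 7, 4⟩, ⟨3, 6, 5⟩, ⟨4, 10, 0⟩, ⟨4, 9, 1⟩, ⟨4, 8, 2⟩, ⟨4, 7, 3⟩, ⟨4, 6, 4⟩, ⟨4, 5, 5⟩, ⟨5, 9, 0⟩, ⟨5, 8, 1⟩, ⟨5, 7, 2⟩, ⟨5, 6, 3⟩, ⟨5, 5, 4⟩, ⟨6, 8, 0⟩, ⟨6, 7, 1⟩, ⟨6, 6, 2⟩, ⟨6, 5, 3⟩, ⟨6, 4, 4⟩, ⟨7, 7, 0⟩, ⟨7, 6, 1⟩, ⟨7, 5, 2⟩, ⟨7, 4, 3⟩, ⟨8, 6, 0⟩, ⟨8, 5, 1⟩, ⟨8, 4, 2⟩, ⟨8, 3, 3⟩, ⟨9, 5,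 0⟩, ⟨9, 4, 1⟩, ⟨9, 3, 2⟩, ⟨10, 4, 0⟩, ⟨10, 3, 1⟩, ⟨10, 2, 2⟩, ⟨11, 3, 0⟩, ⟨11, 2, 1⟩, ⟨12, 2, 0⟩, ⟨12, 1, 1⟩, ⟨13, 1, 0⟩, ⟨14, 0, 0⟩])]

/-- `admP0` through the table (falls through to the definition off-table) -/
def admP0T (h : ℕ) : List Shape := match lookupT admP0Table h with | some l => l | none => admP0 h
/-- `admN0` through the table -/
def admN0T (h : ℕ) : List Shape := match lookupT admN0Table h with | some l => l | none => admN0 h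

theorem admP0Table_ok : (admP0Table.all fun e => decide (e.2 = admP0 e.1)) = true := by decide +kernel

theorem admP0T_eq (h : ℕ) : admP0T h = admP0 h := by
  unfold admP0T
  cases hl : lookupT admP0Table h with
  | none => rfl
  | some l =>
    have := List.all_eq_true.mp admP0Table_ok _ (lookupT_sound hl)
    simpa using this

theorem admN0Table_ok : (admN0Table.all fun e => decide (e.2 = (shapesAt e.1).filter fun σ => (admP0T e.1).any fun τ => belowB τ σ)) = true := by
  decide +kernel

theorem admN0T_eq (h : ℕ) : admN0T h = admN0 h := by
  have key : admN0 h = (shapesAt h).filter fun σ => (admP0T h).any fun τ => belowB τ σ := by rw [admN0, admP0T_eq]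
  unfold admN0T
  cases hl : lookupT admN0Table h with
  | none => rfl
  | some l =>
    have := List.all_eq_true.mp admN0Table_ok _ (lookupT_sound hl)
    rw [key]; simpa using this


/-! ## §2 Statistics, branch variables, regions -/

/-- ordered shape 4-tuple (the class TYPE of a cell) -/
abbrev STuple := Fin 4 → Shape

/-- the type of a cell -/
def typeOf (c : Cell) : STuple := fun f => shapeOf (c f)

/-- a statistic = a finite set of shapes; `count` = number of slots whose shape lies in it -/
structure Stat where
  shapes : List Shape
deriving DecidableEq, Repr

namespace Stat
/-- membership as a `Bool` -/
def memB (s : Stat) (σ : Shape) : Bool := s.shapes.elem σ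
/-- value on a type -/
def count (s : Stat) (t : STuple) : ℕ := ((List.finRange 4).filter fun f => s.memB (t f)).length
end Stat

/-- side of a design -/
inductive Side
  | N
  | P
deriving DecidableEq, Repr

/-- a branch variable: the MAXIMUM of `stat.count` over the supported cells of `side` -/
structure Var where
  side : Side
  stat : Stat
deriving DecidableEq, Repr

/-- the floor statistic at height `h` (floor shapes among the admissible P-shapes) -/
def floorStat (h : ℕ) : Stat := ⟨(admP0T h).filter Shape.isFloor⟩

theorem floorStat_eq (h : ℕ) : floorStat h = ⟨(admP0 h).filter Shape.isFloor⟩ := by rw [floorStat, admP0T_eq]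

/-- a bound `count ≤ cap` on the cells of one side -/
structure Bound where
  side : Side
  stat : Stat
  cap : ℕ
deriving DecidableEq, Repr

/-- a DERIVED bound with its justification: `rule = 0` cover-from-below (an N-statistic bounded by a P-statistic: every shape of `stat`
is covered from below only by shapes of the source's statistic), `1` cover-from-above (P bounded by N), `2` union of two sources,
`3` subset of one source; `src1 ∕ src2` index the list «primary bounds of the leaf ++ earlier derived bounds». -/
structure Derived where
  bound : Bound
  rule : ℕ
  src1 : ℕ
  src2 : ℕ
deriving DecidableEq, Repr

/-- LEVEL-0 block law (see the file header). `y` has length 27, indexed by `fillings` below. -/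
structure Law where
  slot : Fin 4
  y : List ℤ
  K : ℤ
  targ : List (Shape × Shape × Shape)
deriving DecidableEq, Repr

/-- per-variable record of a leaf: the fixed cap (`none` = free), the cover multiplier `Y ≥ 0`, the paid threshold
`thr ∈ {0, 1, 2}` (`1` = an attained maximum has mass `≥ 1`; `2` = attained AND even), and the law indices of its parity certificate
(used iff `thr = 2`). -/
structure VarRec where
  cap : Option ℕ
  Y : ℤ
  thr : ℕ
  par : List ℕ
deriving DecidableEq, Repr

/-- **E1** — a ROW of (A1) with integer multipliers for its real and imaginary parts (cell-level leaves, R19.454 (2)):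
`w2 = none` — the MIXED word `w` (`Design.T w = 0`, (A1).1: `w` not e-free, `w ≠ eeee, ēēēē`);
`w2 = some w'` — the E-FREE DIFFERENCE `w − w'` (`Design.T w = Design.T w'`, (A1).2: both e-free, equal degree).
JSON `{"w":"e1hp","w2":null|"hhpp","lre":int,"lim":int}` (word = 4 letters over `1 h e E p` in slot order, `E = ē`, `p = pt`). -/
structure RowSpec where
  w : Word
  w2 : Option Word
  lre : ℤ
  lim : ℤ

/-- **E1** — the FUNCTIONAL of a leaf: CLASS level (`RingFiveEmpty.Coefs` = multipliers of the six `S₄`-symmetrised e-free (A1).2 rows;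
its value depends on the TYPE only and the pointwise checks run over admissible shape 4-tuples) or CELL level (an integer combination of
real ∕ imaginary parts of arbitrary (A1) rows `RowSpec`; the pointwise checks run over the admissible CELLS = all letter fillings of the
admissible types — enumerated by the checker, so COMPLETENESS «every region-admissible cell is checked» holds by construction
(`mem_admCells`) and no cell list ∕ anchor list is part of the certificate; no orbit folding in this version: `grp = none` implicitly).
JSON `"func": {"kind":"class","gamma":[g2,…,g7]} | {"kind":"cell","rows":[RowSpec,…]}`. -/
inductive Func
  | cls (γ : Coefs)
  | cell (rows : List RowSpec)

/-- A LEAF of the (flattened) branch-and-bound tree; `recs` is aligned with the certificate's `vars`. -/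
structure Leaf where
  recs : List VarRec
  derived : List Derived
  func : Func
  L : ℤ
  ρ : ℤ
  laws : List Law

/-- **The certificate.** -/
structure BnCCert where
  h : ℕ
  B : ℕ
  rmin : ℤ
  vars : List Var
  leaves : List Leaf

/-! ## §3 The checker `valid : BnCCert → Bool` -/

/-- all ordered 4-tuples over a shape list -/
def tuples (l : List Shape) : List STuple :=
  l.flatMap fun s0 => l.flatMap fun s1 => l.flatMap fun s2 => l.map fun s3 => ![s0, s1, s2, s3]

/-- statically admissible shapes of a side (through the literal tables) -/
def adm0 (h : ℕ) : Side → List Shape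
  | Side.N => admN0T h
  | Side.P => admP0T h

theorem adm0_N (h : ℕ) : adm0 h Side.N = admN0 h := admN0T_eq h
theorem adm0_P (h : ℕ) : adm0 h Side.P = admP0 h := admP0T_eq h

/-- the ENTRIES of a leaf: the certificate's variables zipped with the leaf's records -/
def ents (vars : List Var) (lf : Leaf) : List (Var × VarRec) := List.zip vars lf.recs

/-- primary bounds of a leaf: the entries with a fixed cap -/
def primaryBounds (E : List (Var × VarRec)) : List Bound :=
  E.filterMap fun e => e.2.cap.map fun k => (⟨e.1.side, e.1.stat, k⟩ : Bound)

/-- all bounds of a leaf (primary ++ derived, unchecked) -/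
def allBounds (vars : List Var) (lf : Leaf) : List Bound := primaryBounds (ents vars lf) ++ lf.derived.map Derived.bound

/-- a type is admissible on `side` in the region: static admissibility slotwise and every bound of that side -/
def admType (h : ℕ) (bs : List Bound) (sd : Side) (t : STuple) : Bool :=
  ((List.finRange 4).all fun f => (adm0 h sd).elem (t f)) &&
    bs.all fun b => !decide (b.side = sd) || decide (b.stat.count t ≤ b.cap)

/-- the admissible types of a side in the region -/
def admTypes (h : ℕ) (bs : List Bound) (sd : Side) : List STuple := (tuples (adm0 h sd)).filter (admType h bs sd)

/-! ### (E1b, class level) SORTED TYPE ENUMERATION — the `S₄`-folding of the class-leaf pointwise check.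
Every quantity of a CLASS leaf's pointwise check (admissibility, the class functional `Gtype γ`, the cover payments) is invariant
under permuting the four slots, so the check runs over SORTED types only (rank non-decreasing slot by slot; one representative per
slot-permutation class: `C(m+3, 4)` instead of `m⁴` types for an `m`-shape alphabet — the replay-price factor tends to `24`).
Soundness: `checkPt_sound` via `RingFiveEmpty.forall_of_sorted4`. (Laws and parity certificates are slot-specific and keep the
ordered enumeration `admTypes`.) -/

/-- rank of a shape in a one-slot alphabet (position of first occurrence; `length` if absent) -/
def rankOf : List Shape → Shape → ℕ
  | [], _ => 0
  | x :: xs, σ => if x = σ then 0 else rankOf xs σ + 1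

/-- the shape of a given rank -/
def nthD : List Shape → ℕ → Shape
  | [], _ => ⟨0, 0, 0⟩
  | x :: _, 0 => x
  | _ :: xs, n + 1 => nthD xs n

/-- the SORTED 4-tuples over `l` -/
def stuples (l : List Shape) : List STuple :=
  (List.range l.length).flatMap fun i0 => ((List.range l.length).filter fun i1 => i0 ≤ i1).flatMap fun i1 =>
    ((List.range l.length).filter fun i2 => i1 ≤ i2).flatMap fun i2 => ((List.range l.length).filter fun i3 => i2 ≤ i3).map fun i3 =>
      ![nthD l i0, nthD l i1, nthD l i2, nthD l i3]

/-- **(E1b)** the SORTED admissible types of a side in the region -/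
def admTypesSorted (h : ℕ) (bs : List Bound) (sd : Side) : List STuple := (stuples (adm0 h sd)).filter (admType h bs sd)

/-- shape-set inclusion as `Bool` -/
def subsetB (l₁ l₂ : List Shape) : Bool := l₁.all fun σ => l₂.elem σ

/-- check ONE derived bound against the bounds established so far -/
def checkDerived (h : ℕ) (sofar : List Bound) (d : Derived) : Bool :=
  match sofar[d.src1]?, sofar[d.src2]? with
  | some b1, some b2 =>
    (decide (d.rule = 0) && decide (d.bound.side = Side.N) && decide (b1.side = Side.P) && decide (b1.cap ≤ d.bound.cap) &&
        d.bound.stat.shapes.all fun σ => (admP0T h).all fun τ => !belowB τ σ || b1.stat.memB τ) ||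
    (decide (d.rule = 1) && decide (d.bound.side = Side.P) && decide (b1.side = Side.N) && decide (b1.cap ≤ d.bound.cap) &&
        d.bound.stat.shapes.all fun τ => (admN0T h).all fun σ => !belowB τ σ || b1.stat.memB σ) ||
    (decide (d.rule = 2) && decide (b1.side = d.bound.side) && decide (b2.side = d.bound.side) &&
        decide (b1.cap + b2.cap ≤ d.bound.cap) && subsetB d.bound.stat.shapes (b1.stat.shapes ++ b2.stat.shapes)) ||
    (decide (d.rule = 3) && decide (b1.side = d.bound.side) && decide (b1.cap ≤ d.bound.cap) &&
        subsetB d.bound.stat.shapes b1.stat.shapes)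
  | _, _ => false

/-- check all derived bounds of a leaf in order (each may use the primary bounds and the earlier derived ones) -/
def checkDerivedAll (h : ℕ) : List Bound → List Derived → Bool
  | _, [] => true
  | sofar, d :: ds => checkDerived h sofar d && checkDerivedAll h (sofar ++ [d.bound]) ds

/-- e-free fillings of one passive slot -/
inductive Fil
  | one
  | h
  | pt
deriving DecidableEq, Repr

/-- `v(σ) = (1, a, n)` -/
def Fil.v : Fil → Shape → ℤ
  | Fil.one, _ => 1
  | Fil.h, σ => σ.a
  | Fil.pt, σ => σ.n

/-- the 27 fillings `(1,h,pt)³`, lexicographic -/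
def fillings : List (Fil × Fil × Fil) :=
  [Fil.one, Fil.h, Fil.pt].flatMap fun f1 => [Fil.one, Fil.h, Fil.pt].flatMap fun f2 => [Fil.one, Fil.h, Fil.pt].map fun f3 => (f1, f2, f3)

/-- the passive triple of a type w.r.t. the active slot (increasing slot order) -/
def passive (f : Fin 4) (t : STuple) : Shape × Shape × Shape :=
  if f = 0 then (t 1, t 2, t 3) else if f = 1 then (t 0, t 2, t 3) else if f = 2 then (t 0, t 1, t 3) else (t 0, t 1, t 2)

/-- `S_y(τ) = Σ_φ y_φ · v(τ₁)[φ₁] v(τ₂)[φ₂] v(τ₃)[φ₃]` -/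
def lawSum (y : List ℤ) (τ : Shape × Shape × Shape) : ℤ :=
  ((List.zip y fillings).map fun yφ => yφ.1 * (yφ.2.1.v τ.1 * yφ.2.2.1.v τ.2.1 * yφ.2.2.2.v τ.2.2)).sum

/-- 2-adic valuation with fuel (`twoVal n n = v₂(n)` for `n ≥ 1`) -/
def twoVal : ℕ → ℕ → ℕ
  | 0, _ => 0
  | fuel + 1, n => if n = 0 ∨ n % 2 = 1 then 0 else twoVal fuel (n / 2) + 1

/-- `v₂(p² + q²)` of a shape -/
def Shape.val2 (σ : Shape) : ℕ := twoVal σ.bnorm.toNat σ.bnorm.toNat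

/-- membership of `(side, type)` in the law's set `U` (admissible, active letter non-hub, passive triple targeted) -/
def Law.inU (h : ℕ) (bs : List Bound) (law : Law) (sd : Side) (t : STuple) : Bool :=
  admType h bs sd t && !(t law.slot).isHub && law.targ.elem (passive law.slot t)

/-- a law is valid in the region -/
def checkLaw (h : ℕ) (bs : List Bound) (law : Law) : Bool :=
  decide (law.K ≠ 0) && decide (law.y.length = 27) &&
  ([Side.N, Side.P].all fun sd => (admTypes h bs sd).all fun t =>
      (t law.slot).isHub || decide (lawSum law.y (passive law.slot t) = (if law.targ.elem (passive law.slot t) then law.K else 0))) &&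
  -- common 2-adic valuation of `|β|²` of the active shape over `U`
  (let acts := [Side.N, Side.P].flatMap fun sd => ((admTypes h bs sd).filter fun t => law.inU h bs sd t).map fun t => (t law.slot).val2
   acts.all fun v => decide (v = acts.headD 0))

/-- the attaining indicator of variable `i` with cap `k` on side `sd` at type `t` -/
def attains (v : Var) (k : ℕ) (sd : Side) (t : STuple) : Bool := decide (v.side = sd) && decide (v.stat.count t = k)

/-- a parity certificate `par` for the variable `v` at cap `k`: the attaining set of `v` is the pointwise XOR of the `U`-sets of the
laws indexed by `par`, all of which are valid in the region -/
def checkParity (h : ℕ) (bs : List Bound) (laws : List Law) (v : Var) (k : ℕ) (par : List ℕ) : Bool :=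
  (par.all fun j => match laws[j]? with | some law => checkLaw h bs law | none => false) &&
  [Side.N, Side.P].all fun sd => (admTypes h bs sd).all fun t =>
    decide (attains v k sd t =
      par.foldl (fun acc j => match laws[j]? with | some law => acc != law.inU h bs sd t | none => acc) false)

/-- E1 (checker side, kernel-cheap integer pairs `(re, im)`): the coefficient `Sym.coef s ℓ ∈ ℤ[i]` (`coefP_eq`), the product in `ℤ[i]`,
`cellCoef` (`cellCoefP_eq`) and the value of a row on a cell (`rowValP_eq`) -/
def coefP (s : Sym) (ℓ : Letter) : ℤ × ℤ :=
  match s with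
  | Sym.one => (1, 0)
  | Sym.h => (ℓ.a, 0)
  | Sym.e => (ℓ.x, -ℓ.y)
  | Sym.ebar => (ℓ.x, ℓ.y)
  | Sym.pt => (ℓ.a * ℓ.a - (ℓ.x * ℓ.x + ℓ.y * ℓ.y), 0)
def mulP (u v : ℤ × ℤ) : ℤ × ℤ := (u.1 * v.1 - u.2 * v.2, u.1 * v.2 + u.2 * v.1)
def cellCoefP (c : Cell) (w : Word) : ℤ × ℤ :=
  mulP (mulP (mulP (coefP (w 0) (c 0)) (coefP (w 1) (c 1))) (coefP (w 2) (c 2))) (coefP (w 3) (c 3))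
def rowValP (r : RowSpec) (c : Cell) : ℤ × ℤ :=
  match r.w2 with
  | none => cellCoefP c r.w
  | some w' => ((cellCoefP c r.w).1 - (cellCoefP c w').1, (cellCoefP c r.w).2 - (cellCoefP c w').2)

/-- E1 (proof side): the value of a row on a cell in `ℤ[i]` via `DepthBoundA4.cellCoef` -/
def rowVal (r : RowSpec) (c : Cell) : GaussianInt :=
  match r.w2 with
  | none => cellCoef c r.w
  | some w' => cellCoef c r.w - cellCoef c w'

/-- E1: the cell functional `Σ_r λre·Re(row_r) + λim·Im(row_r)` (computed on pairs) -/
def Gc (rows : List RowSpec) (c : Cell) : ℤ := (rows.map fun r => r.lre * (rowValP r c).1 + r.lim * (rowValP r c).2).sum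

/-- e-freeness, equality and degree of words as `Bool` ∕ `ℕ` on the four slots (kernel-evaluable forms of `Word.efree`, `=`, `Word.deg`) -/
def efreeB (w : Word) : Bool := (w 0).efree && (w 1).efree && (w 2).efree && (w 3).efree
def eqW (w w' : Word) : Bool := decide (w 0 = w' 0) && decide (w 1 = w' 1) && decide (w 2 = w' 2) && decide (w 3 = w' 3)
def degB (w : Word) : ℕ := (w 0).deg + (w 1).deg + (w 2).deg + (w 3).deg

/-- E1: a row is a genuine (A1) row -/
def rowOK (r : RowSpec) : Bool :=
  match r.w2 with
  | none => !efreeB r.w && !eqW r.w Word.eeee && !eqW r.w Word.EEEE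
  | some w' => efreeB r.w && efreeB w' && decide (degB r.w = degB w')

/-- the functional of a leaf is well-formed (class: nothing to check; cell: every row is an (A1) row) -/
def funcOK : Func → Bool
  | Func.cls _ => true
  | Func.cell rows => rows.all rowOK

/-- all cells of given slot-wise letter lists -/
def cellTuples (l0 l1 l2 l3 : List Letter) : List Cell :=
  l0.flatMap fun a => l1.flatMap fun b => l2.flatMap fun c => l3.map fun d => ![a, b, c, d]

/-- E1: the admissible CELLS of a side in a region = the letter fillings of its admissible types -/
def admCells (h : ℕ) (bs : List Bound) (sd : Side) : List Cell :=
  (admTypes h bs sd).flatMap fun t => cellTuples (t 0).letters (t 1).letters (t 2).letters (t 3).letters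

/-- sign and bound of a side in the pointwise checks: N-cells `+F + pay ≤ L − ρ`, P-cells `−F + pay ≤ L + ρ` -/
def Side.sgn : Side → ℤ
  | Side.N => 1
  | Side.P => -1
def Side.bnd (L ρ : ℤ) : Side → ℤ
  | Side.N => L - ρ
  | Side.P => L + ρ

/-- `G` on a shape tuple (`RingFiveEmpty.Gpoly` in the class data `(a_f, n_f)`) -/
def Gtype (γ : Coefs) (t : STuple) : ℤ := Gpoly γ (t 0).a (t 0).n (t 1).a (t 1).n (t 2).a (t 2).n (t 3).a (t 3).n

/-- the attaining indicator of an entry on side `sd` at type `t` (`0` for a free variable) -/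
def ind (e : Var × VarRec) (sd : Side) (t : STuple) : ℤ :=
  match e.2.cap with
  | some k => if attains e.1 k sd t then 1 else 0
  | none => 0

/-- `Σ_{i on side sd with fixed cap} Y_i · [count_i t = K_i]` -/
def coverPay (E : List (Var × VarRec)) (sd : Side) (t : STuple) : ℤ := (E.map fun e => e.2.Y * ind e sd t).sum

/-- the threshold of an entry is justified: `thr = 1` needs a fixed cap (an attained maximum), `thr = 2` additionally a parity certificate -/
def thrOK (h : ℕ) (bs : List Bound) (laws : List Law) (e : Var × VarRec) : Bool :=
  decide (e.2.thr = 0) ||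
    match e.2.cap with
    | some k => decide (e.2.thr = 1) || (decide (e.2.thr = 2) && checkParity h bs laws e.1 k e.2.par)
    | none => false

/-- the POINTWISE CHECK of a leaf on one side: class functional over admissible TYPES, cell functional over admissible CELLS -/
def checkPt (h : ℕ) (bs : List Bound) (E : List (Var × VarRec)) (func : Func) (L ρ : ℤ) (sd : Side) : Bool :=
  match func with
  | Func.cls γ => (admTypesSorted h bs sd).all fun t => decide (sd.sgn * Gtype γ t + coverPay E sd t ≤ sd.bnd L ρ)
  | Func.cell rows => (admCells h bs sd).all fun c => decide (sd.sgn * Gc rows c + coverPay E sd (typeOf c) ≤ sd.bnd L ρ)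

/-- **leaf check** -/
def checkLeaf (C : BnCCert) (lf : Leaf) : Bool :=
  let E := ents C.vars lf
  let bs := allBounds C.vars lf
  decide (lf.recs.length = C.vars.length) &&
  checkDerivedAll C.h (primaryBounds E) lf.derived &&
  decide (0 ≤ lf.L) && decide (0 ≤ lf.ρ) &&
  (E.all fun e => decide (0 ≤ e.2.Y) && thrOK C.h bs lf.laws e) &&
  funcOK lf.func &&
  checkPt C.h bs E lf.func lf.L lf.ρ Side.N &&
  checkPt C.h bs E lf.func lf.L lf.ρ Side.P &&
  decide (lf.L * (C.B : ℤ) < (E.map fun e => e.2.Y * (e.2.thr : ℤ)).sum + lf.ρ * C.rmin)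

/-- all value vectors `{0..4}^n` -/
def cube : ℕ → List (List ℕ)
  | 0 => [[]]
  | n + 1 => (cube n).flatMap fun ks => (List.range 5).map fun k => k :: ks

/-- a leaf matches a value vector -/
def matchesB (caps : List (Option ℕ)) (ks : List ℕ) : Bool :=
  (List.zip caps ks).all fun ck => match ck.1 with | some k => decide (k = ck.2) | none => true

/-- **the checker**: variable 0 is the floor variable, every value vector with `K₀ ≥ 1` is matched by a valid leaf. -/
def BnCCert.valid (C : BnCCert) : Bool :=
  decide (C.vars[0]? = some ⟨Side.P, floorStat C.h⟩) &&
  (C.leaves.all fun lf => checkLeaf C lf) &&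
  ((cube C.vars.length).all fun ks => decide (ks.getD 0 0 = 0) || C.leaves.any fun lf => matchesB (lf.recs.map VarRec.cap) ks)

/-! ## §4 Semantics: the value vector of a design and the region of a leaf -/

/-- supported cells of a side -/
def suppSide (D : Design) : Side → List Cell
  | Side.N => D.suppN
  | Side.P => D.suppP

/-- `k` is the maximum of `v.stat.count` over the supported cells of `v.side` (and `0` on an empty side) -/
def IsMax (D : Design) (v : Var) (k : ℕ) : Prop :=
  (∀ c ∈ suppSide D v.side, v.stat.count (typeOf c) ≤ k) ∧ (k = 0 ∨ ∃ c ∈ suppSide D v.side, v.stat.count (typeOf c) = k)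

/-- the design lies in the leaf's region: every fixed cap is the exact maximum of its variable -/
def InRegion (vars : List Var) (lf : Leaf) (D : Design) : Prop :=
  ∀ e ∈ ents vars lf, ∀ k : ℕ, e.2.cap = some k → IsMax D e.1 k

/-! ## §5 Soundness — (S1)(S2)(S5) proved here, (S3) in §4b and (S4) in §4c below; the end-to-end theorems are in §7 -/

/-! ### (S1) STATIC ADMISSIBILITY — PROVED -/

/-- a letter is one of the letters of its shape -/
theorem mem_letters_shapeOf (ℓ : Letter) : ℓ ∈ (shapeOf ℓ).letters := by
  unfold Shape.letters shapeOf
  simp only [List.mem_map, List.mem_dedup]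
  refine ⟨(ℓ.x, ℓ.y), ?_, rfl⟩
  simp only [List.mem_cons, Prod.mk.injEq, List.not_mem_nil, or_false]
  rcases le_total |ℓ.x| |ℓ.y| with hle | hle
  · rw [max_eq_right hle, min_eq_left hle]
    rcases abs_choice ℓ.x with hx | hx <;> rcases abs_choice ℓ.y with hy | hy <;> omega
  · rw [max_eq_left hle, min_eq_right hle]
    rcases abs_choice ℓ.x with hx | hx <;> rcases abs_choice ℓ.y with hy | hy <;> omega

/-- the shape of a height-`h` letter is in `shapesAt h` -/
theorem shapeOf_mem_shapesAt (h : ℕ) (ℓ : Letter) (hA : ℓ.OnAlphabet h) : shapeOf ℓ ∈ shapesAt h := by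
  obtain ⟨hh, ha⟩ := hA
  unfold Letter.height at hh
  obtain ⟨a, hav⟩ := Int.eq_ofNat_of_zero_le ha
  have hq0 : 0 ≤ min |ℓ.x| |ℓ.y| := le_min (abs_nonneg _) (abs_nonneg _)
  obtain ⟨q, hqv⟩ := Int.eq_ofNat_of_zero_le hq0
  have hp0 : 0 ≤ max |ℓ.x| |ℓ.y| := le_trans (abs_nonneg _) (le_max_left _ _)
  obtain ⟨p, hpv⟩ := Int.eq_ofNat_of_zero_le hp0
  have hsum : max |ℓ.x| |ℓ.y| + min |ℓ.x| |ℓ.y| = |ℓ.x| + |ℓ.y| := max_add_min _ _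
  have hqp : min |ℓ.x| |ℓ.y| ≤ max |ℓ.x| |ℓ.y| := min_le_max
  unfold shapesAt shapeOf
  simp only [List.mem_flatMap, List.mem_filterMap, List.mem_range]
  refine ⟨a, by omega, q, by omega, ?_⟩
  rw [if_pos (by omega)]
  simp only [Option.some.injEq, Shape.mk.injEq]
  refine ⟨by omega, by omega, by omega⟩

/-- an ample pair witnesses `belowB` of the shapes -/
theorem belowB_of_ample (lo hi : Letter) (hA : AmpleAbove lo hi) : belowB (shapeOf lo) (shapeOf hi) = true := by
  unfold belowB
  exact List.any_eq_true.mpr ⟨lo, mem_letters_shapeOf lo,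
    List.any_eq_true.mpr ⟨hi, mem_letters_shapeOf hi, (ampleB_iff lo hi).mpr hA⟩⟩

/-- **(S1) STATIC ADMISSIBILITY — PROVED.** On the height-`h` alphabet, under (A4), supported P-letters have shapes in `admP0 h` and
supported N-letters shapes in `admN0 h` (P-letters are off-axis by `DepthBoundA4.no_ample_cover_of_axis`; every letter has a live partner). -/
theorem static_adm (h : ℕ) (D : Design) (hA : D.OnAlphabet h) (h4 : D.A4) :
    (∀ x ∈ D.suppP, ∀ f : Fin 4, shapeOf (x f) ∈ admP0 h) ∧ (∀ y ∈ D.suppN, ∀ f : Fin 4, shapeOf (y f) ∈ admN0 h) := by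
  have hP : ∀ x ∈ D.suppP, ∀ f : Fin 4, shapeOf (x f) ∈ admP0 h := by
    intro x hx f
    obtain ⟨y, hy, hlive⟩ := h4.1 x hx
    have hxA : (x f).OnAlphabet h := hA x (List.mem_append.mpr (Or.inr hx)) f
    have hyA : (y f).OnAlphabet h := hA y (List.mem_append.mpr (Or.inl hy)) f
    have hamp : AmpleAbove (x f) (y f) := hlive f
    unfold admP0
    refine List.mem_filter.mpr ⟨shapeOf_mem_shapesAt h _ hxA, ?_⟩
    rw [Bool.and_eq_true]
    refine ⟨?_, List.any_eq_true.mpr ⟨shapeOf (y f), shapeOf_mem_shapesAt h _ hyA, belowB_of_ample _ _ hamp⟩⟩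
    have hnax : ¬ (x f).isAxis := fun hax =>
      no_ample_cover_of_axis (x f) (y f) (by rw [hxA.1, hyA.1]) hax hamp
    unfold Letter.isAxis at hnax
    have hx0 : (x f).x ≠ 0 := fun h0 => hnax (by rw [h0, zero_mul])
    have hy0 : (x f).y ≠ 0 := fun h0 => hnax (by rw [h0, mul_zero])
    simp only [Shape.offAxis, shapeOf, decide_eq_true_eq]
    exact lt_min (abs_pos.mpr hx0) (abs_pos.mpr hy0)
  refine ⟨hP, fun y hy f => ?_⟩
  obtain ⟨x, hx, hlive⟩ := h4.2 y hy
  have hyA : (y f).OnAlphabet h := hA y (List.mem_append.mpr (Or.inl hy)) f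
  unfold admN0
  exact List.mem_filter.mpr ⟨shapeOf_mem_shapesAt h _ hyA,
    List.any_eq_true.mpr ⟨shapeOf (x f), hP x hx f, belowB_of_ample _ _ (hlive f)⟩⟩

/-! ### (S2) REGION COVER — PROVED -/

/-- a bound HOLDS on a design: every supported cell of its side has statistic `≤ cap` -/
def Holds (D : Design) (b : Bound) : Prop := ∀ c ∈ suppSide D b.side, b.stat.count (typeOf c) ≤ b.cap

theorem count_eq_countP (s : Stat) (t : STuple) : s.count t = (List.finRange 4).countP fun f => s.memB (t f) := by
  rw [Stat.count, List.countP_eq_length_filter]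

theorem count_le_four (s : Stat) (t : STuple) : s.count t ≤ 4 := by
  rw [count_eq_countP]
  exact le_trans List.countP_le_length (by simp)

theorem count_mono (s s' : Stat) (t t' : STuple) (h : ∀ f, s.memB (t f) = true → s'.memB (t' f) = true) :
    s.count t ≤ s'.count t' := by
  rw [count_eq_countP, count_eq_countP]
  exact List.countP_mono_left (fun f _ => h f)

theorem countP_or_le {α : Type} (l : List α) (p q : α → Bool) :
    l.countP (fun a => p a || q a) ≤ l.countP p + l.countP q := by
  induction l with
  | nil => simp
  | cons a l ih =>
    simp only [List.countP_cons]
    cases p a <;> cases q a <;> simp <;> omega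

theorem count_union_le (s s1 s2 : Stat) (t : STuple) (h : subsetB s.shapes (s1.shapes ++ s2.shapes) = true) :
    s.count t ≤ s1.count t + s2.count t := by
  rw [count_eq_countP, count_eq_countP, count_eq_countP]
  refine le_trans (List.countP_mono_left (q := fun f => s1.memB (t f) || s2.memB (t f)) fun f _ hf => ?_)
    (countP_or_le _ _ _)
  unfold subsetB at h
  have hm : t f ∈ s1.shapes ++ s2.shapes :=
    List.mem_of_elem_eq_true (List.all_eq_true.mp h _ (List.mem_of_elem_eq_true hf))
  rw [Bool.or_eq_true]
  rcases List.mem_append.mp hm with h1 | h2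
  · exact Or.inl (List.elem_eq_true_of_mem h1)
  · exact Or.inr (List.elem_eq_true_of_mem h2)

theorem count_subset_le (s s1 : Stat) (t : STuple) (h : subsetB s.shapes s1.shapes = true) :
    s.count t ≤ s1.count t := by
  refine count_mono _ _ _ _ fun f hf => ?_
  unfold subsetB at h
  exact List.all_eq_true.mp h _ (List.mem_of_elem_eq_true hf)

/-- one derived bound is sound given the bounds it is derived from -/
theorem checkDerived_sound (h : ℕ) (D : Design) (hA : D.OnAlphabet h) (h4 : D.A4) (sofar : List Bound) (d : Derived)
    (hchk : checkDerived h sofar d = true) (hs : ∀ b ∈ sofar, Holds D b) : Holds D d.bound := by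
  have hS1 := static_adm h D hA h4
  unfold checkDerived at hchk
  cases h1 : sofar[d.src1]? with
  | none => simp [h1] at hchk
  | some b1 =>
    cases h2 : sofar[d.src2]? with
    | none => simp [h1, h2] at hchk
    | some b2 =>
      simp only [h1, h2] at hchk
      have hb1 : Holds D b1 := hs b1 (List.mem_of_getElem? h1)
      have hb2 : Holds D b2 := hs b2 (List.mem_of_getElem? h2)
      simp only [Bool.or_eq_true, Bool.and_eq_true, decide_eq_true_eq] at hchk
      rcases hchk with ((⟨⟨⟨⟨_, hside⟩, hb1side⟩, hcap⟩, hcov⟩ | ⟨⟨⟨⟨_, hside⟩, hb1side⟩, hcap⟩, hcov⟩) |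
          ⟨⟨⟨⟨_, h1s⟩, h2s⟩, hcap⟩, hsub⟩) | ⟨⟨⟨_, h1s⟩, hcap⟩, hsub⟩
      · -- rule 0: cover from below (d on side N, b1 on side P)
        intro y hy
        rw [hside] at hy
        obtain ⟨x, hx, hlive⟩ := h4.2 y hy
        have hxb : b1.stat.count (typeOf x) ≤ b1.cap := hb1 x (by rw [hb1side]; exact hx)
        have hmono : d.bound.stat.count (typeOf y) ≤ b1.stat.count (typeOf x) := by
          refine count_mono _ _ _ _ fun f hf => ?_
          have hσ : shapeOf (y f) ∈ d.bound.stat.shapes := List.mem_of_elem_eq_true hf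
          have hτ : shapeOf (x f) ∈ admP0T h := by rw [admP0T_eq]; exact hS1.1 x hx f
          have hbel : belowB (shapeOf (x f)) (shapeOf (y f)) = true := belowB_of_ample _ _ (hlive f)
          have hh := List.all_eq_true.mp (List.all_eq_true.mp hcov _ hσ) _ hτ
          rw [hbel] at hh
          show b1.stat.memB (shapeOf (x f)) = true
          simpa using hh
        omega
      · -- rule 1: cover from above (d on side P, b1 on side N)
        intro x hx
        rw [hside] at hx
        obtain ⟨y, hy, hlive⟩ := h4.1 x hx
        have hyb : b1.stat.count (typeOf y) ≤ b1.cap := hb1 y (by rw [hb1side]; exact hy)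
        have hmono : d.bound.stat.count (typeOf x) ≤ b1.stat.count (typeOf y) := by
          refine count_mono _ _ _ _ fun f hf => ?_
          have hτ : shapeOf (x f) ∈ d.bound.stat.shapes := List.mem_of_elem_eq_true hf
          have hσ : shapeOf (y f) ∈ admN0T h := by rw [admN0T_eq]; exact hS1.2 y hy f
          have hbel : belowB (shapeOf (x f)) (shapeOf (y f)) = true := belowB_of_ample _ _ (hlive f)
          have hh := List.all_eq_true.mp (List.all_eq_true.mp hcov _ hτ) _ hσ
          rw [hbel] at hh
          show b1.stat.memB (shapeOf (y f)) = true
          simpa using hh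
        omega
      · -- rule 2: union
        intro c hc
        have hc1 := hb1 c (by rw [h1s]; exact hc)
        have hc2 := hb2 c (by rw [h2s]; exact hc)
        have hu := count_union_le d.bound.stat b1.stat b2.stat (typeOf c) hsub
        omega
      · -- rule 3: subset
        intro c hc
        have hc1 := hb1 c (by rw [h1s]; exact hc)
        have hu := count_subset_le d.bound.stat b1.stat (typeOf c) hsub
        omega

/-- all derived bounds are sound, in order -/
theorem checkDerivedAll_sound (h : ℕ) (D : Design) (hA : D.OnAlphabet h) (h4 : D.A4) :
    ∀ (ds : List Derived) (sofar : List Bound), checkDerivedAll h sofar ds = true →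
      (∀ b ∈ sofar, Holds D b) → ∀ b ∈ sofar ++ ds.map Derived.bound, Holds D b
  | [], sofar, _, hs => by simpa using hs
  | d :: ds, sofar, hchk, hs => by
    simp only [checkDerivedAll, Bool.and_eq_true] at hchk
    have hd := checkDerived_sound h D hA h4 sofar d hchk.1 hs
    have ih := checkDerivedAll_sound h D hA h4 ds (sofar ++ [d.bound]) hchk.2 (by
      intro b hb
      rcases List.mem_append.mp hb with hb | hb
      · exact hs b hb
      · rw [List.mem_singleton] at hb
        rw [hb]; exact hd)
    intro b hb
    apply ih b
    simpa [List.append_assoc] using hb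

/-- the primary bounds hold on a design in the region -/
theorem primary_holds (vars : List Var) (lf : Leaf) (D : Design) (hreg : InRegion vars lf D) :
    ∀ b ∈ primaryBounds (ents vars lf), Holds D b := by
  intro b hb
  unfold primaryBounds at hb
  rw [List.mem_filterMap] at hb
  obtain ⟨e, he, hb⟩ := hb
  cases hc : e.2.cap with
  | none => rw [hc] at hb; simp at hb
  | some k =>
    rw [hc] at hb
    simp at hb
    subst hb
    exact (hreg e he k hc).1

/-- admissibility of every supported cell w.r.t. all bounds of a leaf whose region contains the design -/
theorem adm_of_region (C : BnCCert) (lf : Leaf)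
    (hder : checkDerivedAll C.h (primaryBounds (ents C.vars lf)) lf.derived = true)
    (D : Design) (hA : D.OnAlphabet C.h) (h4 : D.A4) (hreg : InRegion C.vars lf D) :
    ∀ sd : Side, ∀ c' ∈ suppSide D sd, admType C.h (allBounds C.vars lf) sd (typeOf c') = true := by
  have hall : ∀ b ∈ allBounds C.vars lf, Holds D b :=
    checkDerivedAll_sound C.h D hA h4 lf.derived _ hder (primary_holds C.vars lf D hreg)
  have hS1 := static_adm C.h D hA h4
  intro sd c hc
  unfold admType
  rw [Bool.and_eq_true]
  constructor
  · refine List.all_eq_true.mpr fun f _ => List.elem_eq_true_of_mem ?_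
    cases sd with
    | N => show shapeOf (c f) ∈ admN0T C.h; rw [admN0T_eq]; exact hS1.2 c hc f
    | P => show shapeOf (c f) ∈ admP0T C.h; rw [admP0T_eq]; exact hS1.1 c hc f
  · refine List.all_eq_true.mpr fun b hb => ?_
    by_cases hbs : b.side = sd
    · have hb' := hall b hb c (by rw [hbs]; exact hc)
      simp [hbs, hb']
    · simp [hbs]

/-- the VALUE of a variable on a design: the maximum of its statistic over the supported cells of its side (`0` if none) -/
def kOf (D : Design) (v : Var) : ℕ := ((suppSide D v.side).map fun c => v.stat.count (typeOf c)).foldr max 0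

theorem le_foldr_max (l : List ℕ) (x : ℕ) (hx : x ∈ l) : x ≤ l.foldr max 0 := by
  induction l with
  | nil => simp at hx
  | cons a l ih =>
    simp only [List.foldr_cons]
    rcases List.mem_cons.mp hx with rfl | hx
    · exact le_max_left _ _
    · exact le_trans (ih hx) (le_max_right _ _)

theorem foldr_max_le (l : List ℕ) (n : ℕ) (h : ∀ x ∈ l, x ≤ n) : l.foldr max 0 ≤ n := by
  induction l with
  | nil => simp
  | cons a l ih =>
    simp only [List.foldr_cons]
    exact max_le (h a (by simp)) (ih fun x hx => h x (by simp [hx]))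

theorem foldr_max_zero_or_mem (l : List ℕ) : l.foldr max 0 = 0 ∨ l.foldr max 0 ∈ l := by
  induction l with
  | nil => simp
  | cons a l ih =>
    simp only [List.foldr_cons, List.mem_cons]
    rcases le_total a (l.foldr max 0) with hle | hle
    · rw [max_eq_right hle]
      rcases ih with h0 | hm
      · exact Or.inl h0
      · exact Or.inr (Or.inr hm)
    · rw [max_eq_left hle]
      exact Or.inr (Or.inl rfl)

theorem isMax_kOf (D : Design) (v : Var) : IsMax D v (kOf D v) := by
  unfold IsMax kOf
  constructor
  · intro c hc
    exact le_foldr_max _ _ (List.mem_map.mpr ⟨c, hc, rfl⟩)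
  · rcases foldr_max_zero_or_mem ((suppSide D v.side).map fun c => v.stat.count (typeOf c)) with h0 | hm
    · exact Or.inl h0
    · obtain ⟨c, hc, hcnt⟩ := List.mem_map.mp hm
      exact Or.inr ⟨c, hc, hcnt⟩

theorem kOf_le_four (D : Design) (v : Var) : kOf D v ≤ 4 := by
  unfold kOf
  refine foldr_max_le _ _ fun x hx => ?_
  obtain ⟨c, _, rfl⟩ := List.mem_map.mp hx
  exact count_le_four _ _

theorem mem_cube : ∀ (ks : List ℕ), (∀ k ∈ ks, k < 5) → ks ∈ cube ks.length
  | [], _ => by simp [cube]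
  | k :: ks, h => by
    simp only [List.length_cons, cube, List.mem_flatMap, List.mem_map, List.mem_range]
    exact ⟨ks, mem_cube ks fun k' hk' => h k' (by simp [hk']), k, h k (by simp), rfl⟩

/-- **(S2) REGION COVER — PROVED.** For a valid certificate and an (A4) design on the alphabet with a floor letter, the leaf
matching the design's value vector `(kOf D v)_v` exists (cube completeness + the floor cell is a P-cell counted by variable 0),
the design lies in its region, and every supported cell passes `admType` against all of the leaf's bounds (primary by `IsMax`,
derived by `checkDerivedAll_sound`). -/
theorem region_cover (C : BnCCert) (hv : C.valid = true) (D : Design) (hA : D.OnAlphabet C.h) (h4 : D.A4)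
    (c : Cell) (hc : c ∈ D.suppN ++ D.suppP) (f : Fin 4) (hfloor : (c f).a = 0) :
    ∃ lf ∈ C.leaves, InRegion C.vars lf D ∧
      (∀ sd : Side, ∀ c' ∈ suppSide D sd, admType C.h (allBounds C.vars lf) sd (typeOf c') = true) := by
  have hv' := hv
  unfold BnCCert.valid at hv'
  simp only [Bool.and_eq_true, decide_eq_true_eq] at hv'
  obtain ⟨⟨hv0, hleaves⟩, hcube⟩ := hv'
  have hS1 := static_adm C.h D hA h4
  -- the floor cell is a P-cell (nothing lies amply below level 0)
  have hcP : c ∈ D.suppP := by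
    rcases List.mem_append.mp hc with hcN | hcP
    · exfalso
      obtain ⟨x, hx, hlive⟩ := h4.2 c hcN
      have hlt := (hlive f).1
      have hx0 := (hA x (List.mem_append.mpr (Or.inr hx)) f).2
      omega
    · exact hcP
  -- the value vector of the design and its cube cell
  have hkcube : C.vars.map (kOf D) ∈ cube C.vars.length := by
    have hm := mem_cube (C.vars.map (kOf D)) (fun k hk => by
      obtain ⟨v, _, rfl⟩ := List.mem_map.mp hk
      exact Nat.lt_succ_of_le (kOf_le_four D v))
    simpa using hm
  -- variable 0 (the P-floor count) is positive on this design
  have hk0 : (C.vars.map (kOf D)).getD 0 0 ≠ 0 := by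
    cases hvars : C.vars with
    | nil => rw [hvars] at hv0; simp at hv0
    | cons v0 rest =>
      rw [hvars] at hv0
      simp only [List.getElem?_cons_zero, Option.some.injEq] at hv0
      subst hv0
      simp only [List.map_cons, List.getD_cons_zero]
      have hcnt : 0 < (floorStat C.h).count (typeOf c) := by
        unfold Stat.count
        refine List.length_pos_of_mem (List.mem_filter.mpr ⟨List.mem_finRange f, ?_⟩)
        refine List.elem_eq_true_of_mem (List.mem_filter.mpr ⟨by rw [admP0T_eq]; exact hS1.1 c hcP f, ?_⟩)
        simp [Shape.isFloor, shapeOf, typeOf, hfloor]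
      have hle : (floorStat C.h).count (typeOf c) ≤ kOf D ⟨Side.P, floorStat C.h⟩ :=
        (isMax_kOf D ⟨Side.P, floorStat C.h⟩).1 c hcP
      omega
  -- the matching leaf
  have hany := List.all_eq_true.mp hcube _ hkcube
  rw [Bool.or_eq_true, decide_eq_true_eq] at hany
  rcases hany with h0 | hany
  · exact absurd h0 hk0
  obtain ⟨lf, hlf, hmatch⟩ := List.any_eq_true.mp hany
  -- the design is in the leaf's region
  have hreg : InRegion C.vars lf D := by
    intro e he k hk
    obtain ⟨i, hi⟩ := List.mem_iff_getElem?.mp he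
    have hvr := List.getElem?_zip_eq_some.mp hi
    have hz : (List.zip (lf.recs.map VarRec.cap) (C.vars.map (kOf D)))[i]? = some (e.2.cap, kOf D e.1) := by
      apply List.getElem?_zip_eq_some.mpr
      rw [List.getElem?_map, hvr.2, List.getElem?_map, hvr.1]
      exact ⟨rfl, rfl⟩
    unfold matchesB at hmatch
    have hm := List.all_eq_true.mp hmatch _ (List.mem_of_getElem? hz)
    simp only [hk, decide_eq_true_eq] at hm
    rw [hm]
    exact isMax_kOf D e.1
  -- admissibility from the leaf's derived-bound check
  have hchk : checkLeaf C lf = true := List.all_eq_true.mp hleaves lf hlf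
  have hder : checkDerivedAll C.h (primaryBounds (ents C.vars lf)) lf.derived = true := by
    simp only [checkLeaf, Bool.and_eq_true, decide_eq_true_eq] at hchk
    obtain ⟨⟨⟨⟨⟨⟨⟨⟨_, hder⟩, _⟩, _⟩, _⟩, _⟩, _⟩, _⟩, _⟩ := hchk
    exact hder
  exact ⟨lf, hlf, hreg, adm_of_region C lf hder D hA h4 hreg⟩

/-- the parity conclusions a leaf may rely on — exactly the conclusion of (S4), taken as a HYPOTHESIS by `leaf_sound` so that (S5) is
kernel-certified on its own (`depthBound_of_valid`, at the end of the file, discharges it with (S4) `parity_even`) -/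
def ParityOK (C : BnCCert) (lf : Leaf) (D : Design) : Prop :=
  ∀ e ∈ ents C.vars lf, ∀ k : ℕ, e.2.cap = some k → e.2.thr = 2 →
    checkParity C.h (allBounds C.vars lf) lf.laws e.1 k e.2.par = true →
    2 ∣ linZ D.N (fun c => if attains e.1 k Side.N (typeOf c) then 1 else 0)
        + linZ D.P (fun c => if attains e.1 k Side.P (typeOf c) then 1 else 0)

/-! ### (S5) LEAF FARKAS — PROVED (no `sorry`; helpers first) -/

/-- every shape tuple over `l` is enumerated by `tuples l` -/
theorem mem_tuples (l : List Shape) (t : STuple) (h : ∀ f, t f ∈ l) : t ∈ tuples l := by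
  have ht : (![t 0, t 1, t 2, t 3] : STuple) = t := by
    funext f; fin_cases f <;> rfl
  rw [← ht]
  simp only [tuples, List.mem_flatMap, List.mem_map]
  exact ⟨t 0, h 0, t 1, h 1, t 2, h 2, t 3, h 3, rfl⟩

/-- an admissible type is enumerated by `admTypes` -/
theorem mem_admTypes {h : ℕ} {bs : List Bound} {sd : Side} {t : STuple} (ht : admType h bs sd t = true) :
    t ∈ admTypes h bs sd := by
  refine List.mem_filter.mpr ⟨mem_tuples _ t fun f => ?_, ht⟩
  have h1 : ((List.finRange 4).all fun f => (adm0 h sd).elem (t f)) = true := by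
    simp only [admType, Bool.and_eq_true] at ht
    exact ht.1
  exact List.mem_of_elem_eq_true (List.all_eq_true.mp h1 f (List.mem_finRange f))

theorem sq_max_add_sq_min (x y : ℤ) : (max |x| |y|) ^ 2 + (min |x| |y|) ^ 2 = x ^ 2 + y ^ 2 := by
  rcases le_total |x| |y| with hle | hle
  · rw [max_eq_right hle, min_eq_left hle, sq_abs, sq_abs, add_comm]
  · rw [max_eq_left hle, min_eq_right hle, sq_abs, sq_abs]

/-- the class datum `n = a² − |β|²` depends on the shape only -/
theorem shapeOf_n (ℓ : Letter) : (shapeOf ℓ).n = ℓ.selfInt := by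
  simp only [shapeOf, Shape.n, Shape.bnorm, Letter.selfInt, Letter.bnorm, sq_max_add_sq_min]

/-- `RingFiveEmpty.Gcell` factors through the type -/
theorem Gcell_eq_Gtype (γ : Coefs) (c : Cell) : Gcell γ c = Gtype γ (typeOf c) := by
  simp only [Gcell, Gtype, typeOf, shapeOf_n]
  rfl

/-- `linZ` commutes with finite sums of functionals -/
theorem linZ_sum_map {α : Type} (L : List (Cell × ℕ)) (zs : List α) (g : α → Cell → ℤ) :
    linZ L (fun c => (zs.map fun z => g z c).sum) = (zs.map fun z => linZ L (g z)).sum := by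
  induction zs with
  | nil => simp [linZ]
  | cons z zs ih =>
    simp only [List.map_cons, List.sum_cons]
    rw [linZ_add, ih]

/-- a supported cell of positive multiplicity on which `φ = 1` gives `linZ ≥ 1` (for `φ ≥ 0`) -/
theorem one_le_linZ (L : List (Cell × ℕ)) (φ : Cell → ℤ) (hφ : ∀ c, 0 ≤ φ c) (c₀ : Cell) (m₀ : ℕ) (hmem : (c₀, m₀) ∈ L)
    (hpos : 0 < m₀) (h1 : φ c₀ = 1) : 1 ≤ linZ L φ := by
  have h := term_le_linZ L φ hφ c₀ m₀ hmem
  rw [h1, mul_one] at h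
  have : (1 : ℤ) ≤ m₀ := by exact_mod_cast hpos
  linarith

/-- the indicator of an entry is `0 ∕ 1` -/
theorem ind_nonneg (e : Var × VarRec) (sd : Side) (t : STuple) : 0 ≤ ind e sd t := by
  unfold ind
  split
  · split <;> norm_num
  · norm_num

/-! #### E1 lemmas: the cell functional is an (A1)-consequence and the cell enumeration is complete -/

theorem coefP_eq (s : Sym) (ℓ : Letter) : coefP s ℓ = ((s.coef ℓ).re, (s.coef ℓ).im) := by
  cases s <;> simp [coefP, Sym.coef, Letter.beta, Letter.selfInt, Letter.bnorm, sq, Zsqrtd.re_intCast, Zsqrtd.im_intCast,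
    Zsqrtd.re_one, Zsqrtd.im_one]

theorem mulP_eq (z w : GaussianInt) : mulP (z.re, z.im) (w.re, w.im) = ((z * w).re, (z * w).im) := by
  refine Prod.ext ?_ ?_
  · show z.re * w.re - z.im * w.im = (z * w).re
    rw [Zsqrtd.re_mul]
    ring
  · show z.re * w.im + z.im * w.re = (z * w).im
    rw [Zsqrtd.im_mul]

theorem cellCoefP_eq (c : Cell) (w : Word) : cellCoefP c w = ((cellCoef c w).re, (cellCoef c w).im) := by
  simp only [cellCoefP, coefP_eq, mulP_eq, cellCoef, Fin.prod_univ_four]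

theorem rowValP_eq (r : RowSpec) (c : Cell) : rowValP r c = ((rowVal r c).re, (rowVal r c).im) := by
  unfold rowValP rowVal
  cases r.w2 with
  | none => simp only [cellCoefP_eq]
  | some w' => simp only [cellCoefP_eq, Zsqrtd.re_sub, Zsqrtd.im_sub]

theorem efreeB_iff (w : Word) : efreeB w = true ↔ w.efree := by
  simp only [efreeB, Bool.and_eq_true, Word.efree]
  constructor
  · rintro ⟨⟨⟨h0, h1⟩, h2⟩, h3⟩ f
    fin_cases f
    exacts [h0, h1, h2, h3]
  · intro h
    exact ⟨⟨⟨h 0, h 1⟩, h 2⟩, h 3⟩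

theorem eqW_iff (w w' : Word) : eqW w w' = true ↔ w = w' := by
  simp only [eqW, Bool.and_eq_true, decide_eq_true_eq]
  constructor
  · rintro ⟨⟨⟨h0, h1⟩, h2⟩, h3⟩
    funext f
    fin_cases f
    exacts [h0, h1, h2, h3]
  · intro h
    subst h
    exact ⟨⟨⟨rfl, rfl⟩, rfl⟩, rfl⟩

theorem degB_eq (w : Word) : degB w = w.deg := by
  simp only [degB, Word.deg, Fin.sum_univ_four]

theorem linG_sub' (L : List (Cell × ℕ)) (φ ψ : Cell → GaussianInt) :
    linG L (fun c => φ c - ψ c) = linG L φ - linG L ψ := by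
  induction L with
  | nil => simp [linG]
  | cons a t ih => rw [linG_cons, linG_cons, linG_cons, ih]; ring

/-- an (A1) row is BALANCED between the sides: `Σ_N m·row = Σ_P m·row` in `ℤ[i]` (this is literally `Design.A1`, via `T_eq_linG`) -/
theorem row_balance (D : Design) (h1 : D.A1) (r : RowSpec) (hr : rowOK r = true) :
    linG D.N (rowVal r) = linG D.P (rowVal r) := by
  unfold rowOK at hr
  cases hw : r.w2 with
  | none =>
    rw [hw] at hr
    simp only [Bool.and_eq_true, Bool.not_eq_true'] at hr
    obtain ⟨⟨hne, h1e⟩, h2e⟩ := hr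
    have hne' : ¬ r.w.efree := fun h => by rw [(efreeB_iff r.w).mpr h] at hne; exact Bool.noConfusion hne
    have h1e' : r.w ≠ Word.eeee := fun h => by rw [(eqW_iff _ _).mpr h] at h1e; exact Bool.noConfusion h1e
    have h2e' : r.w ≠ Word.EEEE := fun h => by rw [(eqW_iff _ _).mpr h] at h2e; exact Bool.noConfusion h2e
    have hT := h1.1 r.w hne' h1e' h2e'
    rw [T_eq_linG] at hT
    have hφ : rowVal r = fun c => cellCoef c r.w := by
      funext c
      simp only [rowVal, hw]
    rw [hφ]
    exact sub_eq_zero.mp hT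
  | some w' =>
    rw [hw] at hr
    simp only [Bool.and_eq_true, decide_eq_true_eq] at hr
    obtain ⟨⟨he, he'⟩, hdeg⟩ := hr
    have hT := h1.2 r.w w' ((efreeB_iff _).mp he) ((efreeB_iff _).mp he') (by rw [← degB_eq, ← degB_eq, hdeg])
    rw [T_eq_linG, T_eq_linG] at hT
    have hφ : rowVal r = fun c => cellCoef c r.w - cellCoef c w' := by
      funext c
      simp only [rowVal, hw]
    rw [hφ, linG_sub', linG_sub']
    linear_combination hT

/-- the cell functional of a well-formed row list is BALANCED: `Σ_N m·Gc − Σ_P m·Gc = 0` -/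
theorem Gc_balance (D : Design) (h1 : D.A1) (rows : List RowSpec) (hok : rows.all rowOK = true) :
    linZ D.N (Gc rows) - linZ D.P (Gc rows) = 0 := by
  have hexp : ∀ L' : List (Cell × ℕ),
      linZ L' (Gc rows) = (rows.map fun r => r.lre * (linG L' (rowVal r)).re + r.lim * (linG L' (rowVal r)).im).sum := by
    intro L'
    unfold Gc
    simp only [rowValP_eq]
    rw [linZ_sum_map L' rows (fun r c => r.lre * (rowVal r c).re + r.lim * (rowVal r c).im)]
    congr 1
    refine List.map_congr_left fun r _ => ?_
    rw [linZ_add, linZ_smul, linZ_smul, re_linG, im_linG]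
  rw [hexp, hexp, sub_eq_zero]
  congr 1
  refine List.map_congr_left fun r hr => ?_
  rw [row_balance D h1 r (List.all_eq_true.mp hok r hr)]

/-- the value of a leaf functional on a cell -/
def Fval : Func → Cell → ℤ
  | Func.cls γ => Gcell γ
  | Func.cell rows => Gc rows

/-- a well-formed leaf functional is (A1)-BALANCED (class: `RingFiveEmpty.G_vanishes`; cell: `Gc_balance`) -/
theorem Fval_vanishes (D : Design) (h1 : D.A1) (func : Func) (hok : funcOK func = true) :
    linZ D.N (Fval func) - linZ D.P (Fval func) = 0 := by
  cases func with
  | cls γ => exact G_vanishes D h1 γ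
  | cell rows => exact Gc_balance D h1 rows hok

/-- every cell with slot letters in the given lists is enumerated by `cellTuples` -/
theorem mem_cellTuples (l0 l1 l2 l3 : List Letter) (c : Cell) (h0 : c 0 ∈ l0) (h1 : c 1 ∈ l1) (h2 : c 2 ∈ l2) (h3 : c 3 ∈ l3) :
    c ∈ cellTuples l0 l1 l2 l3 := by
  have hc : (![c 0, c 1, c 2, c 3] : Cell) = c := by
    funext f; fin_cases f <;> rfl
  rw [← hc]
  simp only [cellTuples, List.mem_flatMap, List.mem_map]
  exact ⟨c 0, h0, c 1, h1, c 2, h2, c 3, h3, rfl⟩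

/-- **COMPLETENESS of the cell enumeration**: a cell whose type is admissible is among `admCells` -/
theorem mem_admCells {h : ℕ} {bs : List Bound} {sd : Side} {c : Cell} (hadm : admType h bs sd (typeOf c) = true) :
    c ∈ admCells h bs sd := by
  unfold admCells
  rw [List.mem_flatMap]
  refine ⟨typeOf c, mem_admTypes hadm, ?_⟩
  exact mem_cellTuples _ _ _ _ c (mem_letters_shapeOf (c 0)) (mem_letters_shapeOf (c 1)) (mem_letters_shapeOf (c 2))
    (mem_letters_shapeOf (c 3))

/-! ### (E1b) soundness of the sorted enumeration: slot-permutation invariance + `forall_of_sorted4` -/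

theorem nthD_rankOf {l : List Shape} {σ : Shape} (h : σ ∈ l) : nthD l (rankOf l σ) = σ := by
  induction l with
  | nil => cases h
  | cons x xs ih =>
    by_cases hx : x = σ
    · simp [rankOf, nthD, hx]
    · have hm : σ ∈ xs := by
        rcases List.mem_cons.mp h with h' | h'
        · exact absurd h'.symm hx
        · exact h'
      simp [rankOf, nthD, hx, ih hm]

theorem rankOf_lt_length {l : List Shape} {σ : Shape} (h : σ ∈ l) : rankOf l σ < l.length := by
  induction l with
  | nil => cases h
  | cons x xs ih =>
    by_cases hx : x = σ
    · simp [rankOf, hx]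
    · have hm : σ ∈ xs := by
        rcases List.mem_cons.mp h with h' | h'
        · exact absurd h'.symm hx
        · exact h'
      simp only [rankOf, hx, if_false, List.length_cons]
      have := ih hm
      omega

theorem mem_stuples (l : List Shape) (x y z w : Shape) (hx : x ∈ l) (hy : y ∈ l) (hz : z ∈ l) (hw : w ∈ l)
    (h1 : rankOf l x ≤ rankOf l y) (h2 : rankOf l y ≤ rankOf l z) (h3 : rankOf l z ≤ rankOf l w) :
    (![x, y, z, w] : STuple) ∈ stuples l := by
  simp only [stuples, List.mem_flatMap, List.mem_filter, List.mem_range, List.mem_map, decide_eq_true_eq]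
  exact ⟨rankOf l x, rankOf_lt_length hx, rankOf l y, ⟨rankOf_lt_length hy, h1⟩, rankOf l z, ⟨rankOf_lt_length hz, h2⟩,
    rankOf l w, ⟨rankOf_lt_length hw, h3⟩, by rw [nthD_rankOf hx, nthD_rankOf hy, nthD_rankOf hz, nthD_rankOf hw]⟩

theorem finRange4 : List.finRange 4 = [0, 1, 2, 3] := by decide

theorem count_eq_sum (s : Stat) (t : STuple) :
    s.count t = (s.memB (t 0)).toNat + (s.memB (t 1)).toNat + (s.memB (t 2)).toNat + (s.memB (t 3)).toNat := by
  rw [count_eq_countP, finRange4]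
  simp only [List.countP_cons, List.countP_nil]
  cases s.memB (t 0) <;> cases s.memB (t 1) <;> cases s.memB (t 2) <;> cases s.memB (t 3) <;> simp

theorem count_swap01 (s : Stat) (x y z w : Shape) : s.count ![y, x, z, w] = s.count ![x, y, z, w] := by
  rw [count_eq_sum, count_eq_sum]; simp only [Matrix.cons_val_zero, Matrix.cons_val_one, Matrix.cons_val]; omega
theorem count_swap12 (s : Stat) (x y z w : Shape) : s.count ![x, z, y, w] = s.count ![x, y, z, w] := by
  rw [count_eq_sum, count_eq_sum]; simp only [Matrix.cons_val_zero, Matrix.cons_val_one, Matrix.cons_val]; omega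
theorem count_swap23 (s : Stat) (x y z w : Shape) : s.count ![x, y, w, z] = s.count ![x, y, z, w] := by
  rw [count_eq_sum, count_eq_sum]; simp only [Matrix.cons_val_zero, Matrix.cons_val_one, Matrix.cons_val]; omega

theorem admType_static {h : ℕ} {bs : List Bound} {sd : Side} {t : STuple} (ha : admType h bs sd t = true) (f : Fin 4) :
    (adm0 h sd).elem (t f) = true := by
  simp only [admType, Bool.and_eq_true] at ha
  exact List.all_eq_true.mp ha.1 f (List.mem_finRange f)

theorem admType_bound {h : ℕ} {bs : List Bound} {sd : Side} {t : STuple} (ha : admType h bs sd t = true) (b : Bound)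
    (hb : b ∈ bs) (hs : b.side = sd) : b.stat.count t ≤ b.cap := by
  simp only [admType, Bool.and_eq_true] at ha
  have := List.all_eq_true.mp ha.2 b hb
  simpa [hs] using this

theorem admType_intro {h : ℕ} {bs : List Bound} {sd : Side} {t : STuple} (hst : ∀ f, (adm0 h sd).elem (t f) = true)
    (hbd : ∀ b ∈ bs, b.side = sd → b.stat.count t ≤ b.cap) : admType h bs sd t = true := by
  simp only [admType, Bool.and_eq_true, List.all_eq_true]
  refine ⟨fun f _ => hst f, fun b hb => ?_⟩
  by_cases hs : b.side = sd
  · simp [hs, hbd b hb hs]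
  · simp [hs]

theorem admType_swap01 (h : ℕ) (bs : List Bound) (sd : Side) (x y z w : Shape) (ha : admType h bs sd ![y, x, z, w] = true) :
    admType h bs sd ![x, y, z, w] = true := by
  refine admType_intro (fun f => ?_) (fun b hb hs => by rw [← count_swap01]; exact admType_bound ha b hb hs)
  fin_cases f
  · simpa using admType_static ha 1
  · simpa using admType_static ha 0
  · simpa using admType_static ha 2
  · simpa using admType_static ha 3
theorem admType_swap12 (h : ℕ) (bs : List Bound) (sd : Side) (x y z w : Shape) (ha : admType h bs sd ![x, z, y, w] = true) :
    admType h bs sd ![x, y, z, w] = true := by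
  refine admType_intro (fun f => ?_) (fun b hb hs => by rw [← count_swap12]; exact admType_bound ha b hb hs)
  fin_cases f
  · simpa using admType_static ha 0
  · simpa using admType_static ha 2
  · simpa using admType_static ha 1
  · simpa using admType_static ha 3
theorem admType_swap23 (h : ℕ) (bs : List Bound) (sd : Side) (x y z w : Shape) (ha : admType h bs sd ![x, y, w, z] = true) :
    admType h bs sd ![x, y, z, w] = true := by
  refine admType_intro (fun f => ?_) (fun b hb hs => by rw [← count_swap23]; exact admType_bound ha b hb hs)
  fin_cases f
  · simpa using admType_static ha 0
  · simpa using admType_static ha 1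
  · simpa using admType_static ha 3
  · simpa using admType_static ha 2


theorem ind_swap01 (e : Var × VarRec) (sd : Side) (x y z w : Shape) : ind e sd ![y, x, z, w] = ind e sd ![x, y, z, w] := by
  unfold ind attains; rw [count_swap01]
theorem ind_swap12 (e : Var × VarRec) (sd : Side) (x y z w : Shape) : ind e sd ![x, z, y, w] = ind e sd ![x, y, z, w] := by
  unfold ind attains; rw [count_swap12]
theorem ind_swap23 (e : Var × VarRec) (sd : Side) (x y z w : Shape) : ind e sd ![x, y, w, z] = ind e sd ![x, y, z, w] := by
  unfold ind attains; rw [count_swap23]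

theorem coverPay_swap01 (E : List (Var × VarRec)) (sd : Side) (x y z w : Shape) :
    coverPay E sd ![y, x, z, w] = coverPay E sd ![x, y, z, w] := by
  simp only [coverPay, ind_swap01]
theorem coverPay_swap12 (E : List (Var × VarRec)) (sd : Side) (x y z w : Shape) :
    coverPay E sd ![x, z, y, w] = coverPay E sd ![x, y, z, w] := by
  simp only [coverPay, ind_swap12]
theorem coverPay_swap23 (E : List (Var × VarRec)) (sd : Side) (x y z w : Shape) :
    coverPay E sd ![x, y, w, z] = coverPay E sd ![x, y, z, w] := by
  simp only [coverPay, ind_swap23]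

theorem Gtype_swap01 (γ : Coefs) (x y z w : Shape) : Gtype γ ![y, x, z, w] = Gtype γ ![x, y, z, w] := by
  simp only [Gtype, Matrix.cons_val_zero, Matrix.cons_val_one, Matrix.cons_val]
  unfold Gpoly oHH oP oHHH oPH oHHHH oPHH oPP oPHHH oPPH oPPHH oPPP; ring
theorem Gtype_swap12 (γ : Coefs) (x y z w : Shape) : Gtype γ ![x, z, y, w] = Gtype γ ![x, y, z, w] := by
  simp only [Gtype, Matrix.cons_val_zero, Matrix.cons_val_one, Matrix.cons_val]
  unfold Gpoly oHH oP oHHH oPH oHHHH oPHH oPP oPHHH oPPH oPPHH oPPP; ring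
theorem Gtype_swap23 (γ : Coefs) (x y z w : Shape) : Gtype γ ![x, y, w, z] = Gtype γ ![x, y, z, w] := by
  simp only [Gtype, Matrix.cons_val_zero, Matrix.cons_val_one, Matrix.cons_val]
  unfold Gpoly oHH oP oHHH oPH oHHHH oPHH oPP oPHHH oPPH oPPHH oPPP; ring

/-- the class-leaf pointwise predicate on an explicit type -/
def ClsPt (h : ℕ) (bs : List Bound) (E : List (Var × VarRec)) (γ : Coefs) (L ρ : ℤ) (sd : Side) (x y z w : Shape) : Prop :=
  admType h bs sd ![x, y, z, w] = true → sd.sgn * Gtype γ ![x, y, z, w] + coverPay E sd ![x, y, z, w] ≤ sd.bnd L ρ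

/-- **(E1b) transport**: the sorted check implies the pointwise inequality at EVERY admissible type -/
theorem clsPt_all {h : ℕ} {bs : List Bound} {E : List (Var × VarRec)} {γ : Coefs} {L ρ : ℤ} {sd : Side}
    (hchk : ∀ t ∈ admTypesSorted h bs sd, sd.sgn * Gtype γ t + coverPay E sd t ≤ sd.bnd L ρ) :
    ∀ x y z w, ClsPt h bs E γ L ρ sd x y z w := by
  refine forall_of_sorted4 (rankOf (adm0 h sd)) (ClsPt h bs E γ L ρ sd) ?_ ?_ ?_ ?_
  · intro x y z w hP ha
    have := hP (admType_swap01 h bs sd x y z w ha)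
    rw [← Gtype_swap01, ← coverPay_swap01] at this
    exact this
  · intro x y z w hP ha
    have := hP (admType_swap12 h bs sd x y z w ha)
    rw [← Gtype_swap12, ← coverPay_swap12] at this
    exact this
  · intro x y z w hP ha
    have := hP (admType_swap23 h bs sd x y z w ha)
    rw [← Gtype_swap23, ← coverPay_swap23] at this
    exact this
  · intro x y z w h1 h2 h3 ha
    have hx : (adm0 h sd).elem x = true := by simpa using admType_static ha 0
    have hy : (adm0 h sd).elem y = true := by simpa using admType_static ha 1
    have hz : (adm0 h sd).elem z = true := by simpa using admType_static ha 2
    have hw : (adm0 h sd).elem w = true := by simpa using admType_static ha 3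
    exact hchk _ (List.mem_filter.mpr ⟨mem_stuples _ x y z w (List.mem_of_elem_eq_true hx) (List.mem_of_elem_eq_true hy)
      (List.mem_of_elem_eq_true hz) (List.mem_of_elem_eq_true hw) h1 h2 h3, ha⟩)

/-- the pointwise check is sound on every supported cell of an admissible type (class: via the type; cell: via completeness) -/
theorem checkPt_sound {h : ℕ} {bs : List Bound} {E : List (Var × VarRec)} {func : Func} {L ρ : ℤ} {sd : Side}
    (hchk : checkPt h bs E func L ρ sd = true) (c : Cell) (hadm : admType h bs sd (typeOf c) = true) :
    sd.sgn * Fval func c + coverPay E sd (typeOf c) ≤ sd.bnd L ρ := by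
  cases func with
  | cls γ =>
    simp only [checkPt, List.all_eq_true, decide_eq_true_eq] at hchk
    have ht : (![typeOf c 0, typeOf c 1, typeOf c 2, typeOf c 3] : STuple) = typeOf c := by
      funext f; fin_cases f <;> rfl
    have := clsPt_all hchk (typeOf c 0) (typeOf c 1) (typeOf c 2) (typeOf c 3)
    rw [ClsPt, ht] at this
    simp only [Fval, Gcell_eq_Gtype]
    exact this hadm
  | cell rows =>
    simp only [checkPt, List.all_eq_true, decide_eq_true_eq] at hchk
    exact hchk c (mem_admCells hadm)

/-- **(S5) LEAF FARKAS — PROVED** (sorry-free; the parity conclusions of (S4) enter as the hypothesis `hparity`, used only for entries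
with `thr = 2`). In the region of a checked leaf no (A1)-clean design with both sides non-empty, `copies ≤ B`, `rank ≥ rmin` exists: `0 = Σ_N m·G − Σ_P m·G` (`RingFiveEmpty.G_vanishes`) `≤ (L−ρ)·M_N + (L+ρ)·M_P − Σ_i Y_i·mass(attaining_i)`
(the two pointwise checks, summed) `≤ L·B − ρ·rmin − Σ_i Y_i·thr_i` (an attained maximum over a non-empty side has mass `≥ 1`;
with a parity certificate (S4) it is even, hence `≥ 2`) `< 0` (closing inequality). -/
theorem leaf_sound (C : BnCCert) (lf : Leaf) (hlf : checkLeaf C lf = true) (D : Design) (h1 : D.A1)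
    (hB : D.copies ≤ C.B) (hr : C.rmin ≤ D.rank) (hN : D.suppN ≠ []) (hP : D.suppP ≠ []) (hreg : InRegion C.vars lf D)
    (hadm : ∀ sd : Side, ∀ c' ∈ suppSide D sd, admType C.h (allBounds C.vars lf) sd (typeOf c') = true)
    (hparity : ParityOK C lf D) : False := by
  simp only [checkLeaf, Bool.and_eq_true, decide_eq_true_eq, List.all_eq_true] at hlf
  obtain ⟨⟨⟨⟨⟨⟨⟨⟨_hlen, _hder⟩, hL⟩, hρ⟩, hYthr⟩, hfok⟩, hNall⟩, hPall⟩, hclose⟩ := hlf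
  -- the masses
  have hMN0 : (0 : ℤ) ≤ ((D.N.map Prod.snd).sum : ℕ) := by positivity
  have hMP0 : (0 : ℤ) ≤ ((D.P.map Prod.snd).sum : ℕ) := by positivity
  have hcop : (((D.N.map Prod.snd).sum : ℕ) : ℤ) + ((D.P.map Prod.snd).sum : ℕ) ≤ C.B := by
    have : D.copies ≤ C.B := hB
    unfold Design.copies at this
    exact_mod_cast this
  have hrk : C.rmin ≤ (((D.N.map Prod.snd).sum : ℕ) : ℤ) - ((D.P.map Prod.snd).sum : ℕ) := by
    unfold Design.rank at hr
    exact hr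
  -- (1) the e-free identity
  have hvan := Fval_vanishes D h1 lf.func hfok
  -- (2) the two pointwise checks, summed over the sides
  have hNsum : linZ D.N (fun c => Fval lf.func c + coverPay (ents C.vars lf) Side.N (typeOf c))
      ≤ (lf.L - lf.ρ) * ((D.N.map Prod.snd).sum : ℕ) := by
    refine linZ_le_mul_sum D.N _ _ fun cm hcm hpos => ?_
    have hsupp : cm.1 ∈ D.suppN := (mem_suppN_iff D cm.1).mpr ⟨cm.2, hcm, hpos⟩
    have hineq := checkPt_sound hNall cm.1 (hadm Side.N cm.1 hsupp)
    simp only [Side.sgn, Side.bnd, one_mul] at hineq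
    exact hineq
  have hPsum : linZ D.P (fun c => -Fval lf.func c + coverPay (ents C.vars lf) Side.P (typeOf c))
      ≤ (lf.L + lf.ρ) * ((D.P.map Prod.snd).sum : ℕ) := by
    refine linZ_le_mul_sum D.P _ _ fun cm hcm hpos => ?_
    have hsupp : cm.1 ∈ D.suppP := (mem_suppP_iff D cm.1).mpr ⟨cm.2, hcm, hpos⟩
    have hineq := checkPt_sound hPall cm.1 (hadm Side.P cm.1 hsupp)
    simp only [Side.sgn, Side.bnd, neg_mul, one_mul] at hineq
    exact hineq
  rw [linZ_add] at hNsum hPsum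
  have hneg : linZ D.P (fun c => -Fval lf.func c) = -linZ D.P (Fval lf.func) := by
    have h := linZ_smul D.P (-1) (Fval lf.func)
    simp only [neg_mul, one_mul] at h
    exact h
  rw [hneg] at hPsum
  -- (3) the cover payments, exchanged: `Σ_c m_c·coverPay(c) = Σ_i Y_i · mass_i`
  have hpay : ∀ (L' : List (Cell × ℕ)) (sd : Side), linZ L' (fun c => coverPay (ents C.vars lf) sd (typeOf c))
      = ((ents C.vars lf).map fun e => e.2.Y * linZ L' (fun c => ind e sd (typeOf c))).sum := by
    intro L' sd
    unfold coverPay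
    rw [linZ_sum_map L' (ents C.vars lf) (fun e c => e.2.Y * ind e sd (typeOf c))]
    congr 1
    refine List.map_congr_left fun e _ => ?_
    exact linZ_smul L' _ _
  rw [hpay] at hNsum hPsum
  -- (4) per entry: `Y·thr ≤ Y·(mass_N + mass_P)`
  have hne : ∀ sd : Side, suppSide D sd ≠ [] := fun sd => by
    cases sd
    · exact hN
    · exact hP
  have hent : ∀ e ∈ ents C.vars lf, e.2.Y * (e.2.thr : ℤ)
      ≤ e.2.Y * linZ D.N (fun c => ind e Side.N (typeOf c)) + e.2.Y * linZ D.P (fun c => ind e Side.P (typeOf c)) := by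
    intro e he
    obtain ⟨hY, hthr⟩ := hYthr e he
    rw [← mul_add]
    apply mul_le_mul_of_nonneg_left _ hY
    have hmN : 0 ≤ linZ D.N (fun c => ind e Side.N (typeOf c)) := linZ_nonneg _ _ fun cm _ _ => ind_nonneg _ _ _
    have hmP : 0 ≤ linZ D.P (fun c => ind e Side.P (typeOf c)) := linZ_nonneg _ _ fun cm _ _ => ind_nonneg _ _ _
    simp only [thrOK, Bool.or_eq_true, decide_eq_true_eq] at hthr
    rcases hthr with h0 | hcap
    · rw [h0]; push_cast; linarith
    · cases hc : e.2.cap with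
      | none => simp only [hc] at hcap; exact absurd hcap Bool.false_ne_true
      | some k =>
        simp only [hc, Bool.or_eq_true, Bool.and_eq_true, decide_eq_true_eq] at hcap
        -- an attained maximum over a non-empty side has mass ≥ 1
        have hmax := hreg e he k hc
        obtain ⟨c₀, hc₀, hcnt⟩ : ∃ c₀ ∈ suppSide D e.1.side, e.1.stat.count (typeOf c₀) = k := by
          rcases hmax.2 with hk0 | hex
          · obtain ⟨c₀, hc₀⟩ := List.exists_mem_of_ne_nil _ (hne e.1.side)
            refine ⟨c₀, hc₀, ?_⟩
            have := hmax.1 c₀ hc₀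
            omega
          · exact hex
        have hge1 : 1 ≤ linZ D.N (fun c => ind e Side.N (typeOf c)) + linZ D.P (fun c => ind e Side.P (typeOf c)) := by
          have key : ∀ sd : Side, e.1.side = sd → c₀ ∈ suppSide D sd →
              1 ≤ linZ D.N (fun c => ind e Side.N (typeOf c)) + linZ D.P (fun c => ind e Side.P (typeOf c)) := by
            intro sd hsd hc₀'
            have hind1 : ind e sd (typeOf c₀) = 1 := by
              simp [ind, hc, attains, hsd, hcnt]
            cases sd with
            | N =>
              obtain ⟨m₀, hm₀, hpos₀⟩ := (mem_suppN_iff D c₀).mp hc₀'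
              have := one_le_linZ D.N _ (fun c => ind_nonneg _ _ _) c₀ m₀ hm₀ hpos₀ hind1
              linarith
            | P =>
              obtain ⟨m₀, hm₀, hpos₀⟩ := (mem_suppP_iff D c₀).mp hc₀'
              have := one_le_linZ D.P _ (fun c => ind_nonneg _ _ _) c₀ m₀ hm₀ hpos₀ hind1
              linarith
          exact key _ rfl hc₀
        rcases hcap with h1' | ⟨h2, hpar⟩
        · rw [h1']; push_cast; linarith
        · rw [h2]
          have heven := hparity e he k hc h2 hpar
          have hindk : ∀ sd : Side, (fun c => ind e sd (typeOf c)) = fun c => if attains e.1 k sd (typeOf c) then (1 : ℤ) else 0 := by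
            intro sd
            funext c
            simp [ind, hc]
          rw [hindk Side.N, hindk Side.P] at hge1 ⊢
          obtain ⟨q, hq⟩ := heven
          push_cast
          omega
  -- (5) sum over the entries and close
  have hsum : ((ents C.vars lf).map fun e => e.2.Y * (e.2.thr : ℤ)).sum
      ≤ ((ents C.vars lf).map fun e => e.2.Y * linZ D.N (fun c => ind e Side.N (typeOf c))).sum
        + ((ents C.vars lf).map fun e => e.2.Y * linZ D.P (fun c => ind e Side.P (typeOf c))).sum := by
    rw [← List.sum_map_add]
    exact List.sum_le_sum hent
  have hLB : lf.L * ((((D.N.map Prod.snd).sum : ℕ) : ℤ) + ((D.P.map Prod.snd).sum : ℕ)) ≤ lf.L * (C.B : ℤ) :=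
    mul_le_mul_of_nonneg_left hcop hL
  have hρr : lf.ρ * C.rmin ≤ lf.ρ * ((((D.N.map Prod.snd).sum : ℕ) : ℤ) - ((D.P.map Prod.snd).sum : ℕ)) :=
    mul_le_mul_of_nonneg_left hrk hρ
  nlinarith [hvan, hNsum, hPsum, hsum, hclose, hLB, hρr]

/-! ### (E1c) UNIVERSE-RELATIVE CELL LEAVES — an EXPLICIT cell list instead of a region (R19.492 «C2 shape»; gs-eng-2 l.9639 ∕ l.9812).
The pointwise check runs over GIVEN lists of N- and P-cells; soundness = the leaf Farkas step factored through its pointwise core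
(`leaf_core`) and certifies exactly the UNIVERSE-RELATIVE statement `leafOn_sound`: no (A1) design supported inside the lists, lying in
the leaf's region (every capped variable an attained maximum), with `copies ≤ B`, `rank ≥ rmin`, both sides non-empty.  The JUSTIFICATION
of a list (why the designs of interest are supported in it — for XBASE-LOCK: XBASE-12 types · exact budget lemma `M₄ ≤ 1` · W1 anchor
WLOG · the (A4) lock tables) is NOT part of such a certificate: it is data there and separate theorems here.  Nothing in (E1c) is a floor. -/

/-- the common (non-pointwise) conjuncts of a leaf check -/
def checkLeafCore (C : BnCCert) (lf : Leaf) : Bool :=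
  let E := ents C.vars lf
  let bs := allBounds C.vars lf
  decide (lf.recs.length = C.vars.length) &&
  checkDerivedAll C.h (primaryBounds E) lf.derived &&
  decide (0 ≤ lf.L) && decide (0 ≤ lf.ρ) &&
  (E.all fun e => decide (0 ≤ e.2.Y) && thrOK C.h bs lf.laws e) &&
  funcOK lf.func &&
  decide (lf.L * (C.B : ℤ) < (E.map fun e => e.2.Y * (e.2.thr : ℤ)).sum + lf.ρ * C.rmin)

/-- (E1c) the pointwise check of a leaf functional on an EXPLICIT cell list -/
def checkPtOn (E : List (Var × VarRec)) (func : Func) (L ρ : ℤ) (sd : Side) (U : List Cell) : Bool :=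
  U.all fun c => decide (sd.sgn * Fval func c + coverPay E sd (typeOf c) ≤ sd.bnd L ρ)

/-- (E1c) **universe-relative leaf check**: core conjuncts + the pointwise checks on the given N- and P-cell lists -/
def checkLeafOn (C : BnCCert) (lf : Leaf) (UN UP : List Cell) : Bool :=
  checkLeafCore C lf && checkPtOn (ents C.vars lf) lf.func lf.L lf.ρ Side.N UN && checkPtOn (ents C.vars lf) lf.func lf.L lf.ρ Side.P UP

/-- the cell universe of a side -/
def univSide (UN UP : List Cell) : Side → List Cell
  | Side.N => UN
  | Side.P => UP

/-- **(S5) CORE** — the leaf Farkas step from the POINTWISE inequalities on the supported cells, however they were obtained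
(`leaf_sound`: from the region's enumeration; `leafOn_sound`: from an explicit list). -/
theorem leaf_core (C : BnCCert) (lf : Leaf) (hcore : checkLeafCore C lf = true) (D : Design) (h1 : D.A1)
    (hB : D.copies ≤ C.B) (hr : C.rmin ≤ D.rank) (hN : D.suppN ≠ []) (hP : D.suppP ≠ []) (hreg : InRegion C.vars lf D)
    (hpt : ∀ sd : Side, ∀ c' ∈ suppSide D sd,
      sd.sgn * Fval lf.func c' + coverPay (ents C.vars lf) sd (typeOf c') ≤ sd.bnd lf.L lf.ρ)
    (hparity : ParityOK C lf D) : False := by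
  simp only [checkLeafCore, Bool.and_eq_true, decide_eq_true_eq, List.all_eq_true] at hcore
  obtain ⟨⟨⟨⟨⟨⟨_hlen, _hder⟩, hL⟩, hρ⟩, hYthr⟩, _hfok⟩, hclose⟩ := hcore
  have hfok : funcOK lf.func = true := _hfok
  -- the masses
  have hMN0 : (0 : ℤ) ≤ ((D.N.map Prod.snd).sum : ℕ) := by positivity
  have hMP0 : (0 : ℤ) ≤ ((D.P.map Prod.snd).sum : ℕ) := by positivity
  have hcop : (((D.N.map Prod.snd).sum : ℕ) : ℤ) + ((D.P.map Prod.snd).sum : ℕ) ≤ C.B := by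
    have : D.copies ≤ C.B := hB
    unfold Design.copies at this
    exact_mod_cast this
  have hrk : C.rmin ≤ (((D.N.map Prod.snd).sum : ℕ) : ℤ) - ((D.P.map Prod.snd).sum : ℕ) := by
    unfold Design.rank at hr
    exact hr
  -- (1) the e-free identity
  have hvan := Fval_vanishes D h1 lf.func hfok
  -- (2) the two pointwise checks, summed over the sides
  have hNsum : linZ D.N (fun c => Fval lf.func c + coverPay (ents C.vars lf) Side.N (typeOf c))
      ≤ (lf.L - lf.ρ) * ((D.N.map Prod.snd).sum : ℕ) := by
    refine linZ_le_mul_sum D.N _ _ fun cm hcm hpos => ?_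
    have hsupp : cm.1 ∈ D.suppN := (mem_suppN_iff D cm.1).mpr ⟨cm.2, hcm, hpos⟩
    have hineq := hpt Side.N cm.1 hsupp
    simp only [Side.sgn, Side.bnd, one_mul] at hineq
    exact hineq
  have hPsum : linZ D.P (fun c => -Fval lf.func c + coverPay (ents C.vars lf) Side.P (typeOf c))
      ≤ (lf.L + lf.ρ) * ((D.P.map Prod.snd).sum : ℕ) := by
    refine linZ_le_mul_sum D.P _ _ fun cm hcm hpos => ?_
    have hsupp : cm.1 ∈ D.suppP := (mem_suppP_iff D cm.1).mpr ⟨cm.2, hcm, hpos⟩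
    have hineq := hpt Side.P cm.1 hsupp
    simp only [Side.sgn, Side.bnd, neg_mul, one_mul] at hineq
    exact hineq
  rw [linZ_add] at hNsum hPsum
  have hneg : linZ D.P (fun c => -Fval lf.func c) = -linZ D.P (Fval lf.func) := by
    have h := linZ_smul D.P (-1) (Fval lf.func)
    simp only [neg_mul, one_mul] at h
    exact h
  rw [hneg] at hPsum
  -- (3) the cover payments, exchanged: `Σ_c m_c·coverPay(c) = Σ_i Y_i · mass_i`
  have hpay : ∀ (L' : List (Cell × ℕ)) (sd : Side), linZ L' (fun c => coverPay (ents C.vars lf) sd (typeOf c))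
      = ((ents C.vars lf).map fun e => e.2.Y * linZ L' (fun c => ind e sd (typeOf c))).sum := by
    intro L' sd
    unfold coverPay
    rw [linZ_sum_map L' (ents C.vars lf) (fun e c => e.2.Y * ind e sd (typeOf c))]
    congr 1
    refine List.map_congr_left fun e _ => ?_
    exact linZ_smul L' _ _
  rw [hpay] at hNsum hPsum
  -- (4) per entry: `Y·thr ≤ Y·(mass_N + mass_P)`
  have hne : ∀ sd : Side, suppSide D sd ≠ [] := fun sd => by
    cases sd
    · exact hN
    · exact hP
  have hent : ∀ e ∈ ents C.vars lf, e.2.Y * (e.2.thr : ℤ)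
      ≤ e.2.Y * linZ D.N (fun c => ind e Side.N (typeOf c)) + e.2.Y * linZ D.P (fun c => ind e Side.P (typeOf c)) := by
    intro e he
    obtain ⟨hY, hthr⟩ := hYthr e he
    rw [← mul_add]
    apply mul_le_mul_of_nonneg_left _ hY
    have hmN : 0 ≤ linZ D.N (fun c => ind e Side.N (typeOf c)) := linZ_nonneg _ _ fun cm _ _ => ind_nonneg _ _ _
    have hmP : 0 ≤ linZ D.P (fun c => ind e Side.P (typeOf c)) := linZ_nonneg _ _ fun cm _ _ => ind_nonneg _ _ _
    simp only [thrOK, Bool.or_eq_true, decide_eq_true_eq] at hthr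
    rcases hthr with h0 | hcap
    · rw [h0]; push_cast; linarith
    · cases hc : e.2.cap with
      | none => simp only [hc] at hcap; exact absurd hcap Bool.false_ne_true
      | some k =>
        simp only [hc, Bool.or_eq_true, Bool.and_eq_true, decide_eq_true_eq] at hcap
        -- an attained maximum over a non-empty side has mass ≥ 1
        have hmax := hreg e he k hc
        obtain ⟨c₀, hc₀, hcnt⟩ : ∃ c₀ ∈ suppSide D e.1.side, e.1.stat.count (typeOf c₀) = k := by
          rcases hmax.2 with hk0 | hex
          · obtain ⟨c₀, hc₀⟩ := List.exists_mem_of_ne_nil _ (hne e.1.side)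
            refine ⟨c₀, hc₀, ?_⟩
            have := hmax.1 c₀ hc₀
            omega
          · exact hex
        have hge1 : 1 ≤ linZ D.N (fun c => ind e Side.N (typeOf c)) + linZ D.P (fun c => ind e Side.P (typeOf c)) := by
          have key : ∀ sd : Side, e.1.side = sd → c₀ ∈ suppSide D sd →
              1 ≤ linZ D.N (fun c => ind e Side.N (typeOf c)) + linZ D.P (fun c => ind e Side.P (typeOf c)) := by
            intro sd hsd hc₀'
            have hind1 : ind e sd (typeOf c₀) = 1 := by
              simp [ind, hc, attains, hsd, hcnt]
            cases sd with
            | N =>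
              obtain ⟨m₀, hm₀, hpos₀⟩ := (mem_suppN_iff D c₀).mp hc₀'
              have := one_le_linZ D.N _ (fun c => ind_nonneg _ _ _) c₀ m₀ hm₀ hpos₀ hind1
              linarith
            | P =>
              obtain ⟨m₀, hm₀, hpos₀⟩ := (mem_suppP_iff D c₀).mp hc₀'
              have := one_le_linZ D.P _ (fun c => ind_nonneg _ _ _) c₀ m₀ hm₀ hpos₀ hind1
              linarith
          exact key _ rfl hc₀
        rcases hcap with h1' | ⟨h2, hpar⟩
        · rw [h1']; push_cast; linarith
        · rw [h2]
          have heven := hparity e he k hc h2 hpar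
          have hindk : ∀ sd : Side, (fun c => ind e sd (typeOf c)) = fun c => if attains e.1 k sd (typeOf c) then (1 : ℤ) else 0 := by
            intro sd
            funext c
            simp [ind, hc]
          rw [hindk Side.N, hindk Side.P] at hge1 ⊢
          obtain ⟨q, hq⟩ := heven
          push_cast
          omega
  -- (5) sum over the entries and close
  have hsum : ((ents C.vars lf).map fun e => e.2.Y * (e.2.thr : ℤ)).sum
      ≤ ((ents C.vars lf).map fun e => e.2.Y * linZ D.N (fun c => ind e Side.N (typeOf c))).sum
        + ((ents C.vars lf).map fun e => e.2.Y * linZ D.P (fun c => ind e Side.P (typeOf c))).sum := by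
    rw [← List.sum_map_add]
    exact List.sum_le_sum hent
  have hLB : lf.L * ((((D.N.map Prod.snd).sum : ℕ) : ℤ) + ((D.P.map Prod.snd).sum : ℕ)) ≤ lf.L * (C.B : ℤ) :=
    mul_le_mul_of_nonneg_left hcop hL
  have hρr : lf.ρ * C.rmin ≤ lf.ρ * ((((D.N.map Prod.snd).sum : ℕ) : ℤ) - ((D.P.map Prod.snd).sum : ℕ)) :=
    mul_le_mul_of_nonneg_left hrk hρ
  nlinarith [hvan, hNsum, hPsum, hsum, hclose, hLB, hρr]

/-- **(E1c) SOUNDNESS of a universe-relative cell leaf.** -/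
theorem leafOn_sound (C : BnCCert) (lf : Leaf) (UN UP : List Cell) (hchk : checkLeafOn C lf UN UP = true) (D : Design)
    (h1 : D.A1) (hB : D.copies ≤ C.B) (hr : C.rmin ≤ D.rank) (hN : D.suppN ≠ []) (hP : D.suppP ≠ []) (hreg : InRegion C.vars lf D)
    (hU : ∀ sd : Side, ∀ c' ∈ suppSide D sd, c' ∈ univSide UN UP sd) (hparity : ParityOK C lf D) : False := by
  simp only [checkLeafOn, Bool.and_eq_true] at hchk
  obtain ⟨⟨hcore, hNall⟩, hPall⟩ := hchk
  refine leaf_core C lf hcore D h1 hB hr hN hP hreg (fun sd c' hc' => ?_) hparity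
  cases sd with
  | N =>
    simp only [checkPtOn, List.all_eq_true, decide_eq_true_eq] at hNall
    exact hNall c' (hU Side.N c' hc')
  | P =>
    simp only [checkPtOn, List.all_eq_true, decide_eq_true_eq] at hPall
    exact hPall c' (hU Side.P c' hc')

/-- a leaf without `thr = 2` records needs no parity conclusions -/
theorem parityOK_of_noThr2 (C : BnCCert) (lf : Leaf) (D : Design) (h : (lf.recs.all fun r => !decide (r.thr = 2)) = true) :
    ParityOK C lf D := by
  intro e he k _ h2 _
  exfalso
  have hmem : e.2 ∈ lf.recs := (List.of_mem_zip he).2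
  have := List.all_eq_true.mp h _ hmem
  simp [h2] at this

/-- a design of positive rank has a non-empty N side -/
theorem suppN_ne_nil_of_rank (D : Design) (r : ℤ) (hr : r ≤ D.rank) (hpos : 0 < r) : D.suppN ≠ [] := by
  intro hnil
  unfold Design.rank at hr
  unfold Design.suppN at hnil
  have hfil : D.N.filter (fun cm => 0 < cm.2) = [] := List.map_eq_nil_iff.mp hnil
  have hall : ∀ x ∈ D.N.map Prod.snd, x = 0 := by
    intro x hx
    obtain ⟨cm, hcm, rfl⟩ := List.mem_map.mp hx
    have := List.filter_eq_nil_iff.mp hfil cm hcm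
    simp at this
    omega
  have hz : (D.N.map Prod.snd).sum = 0 := List.sum_eq_zero hall
  rw [hz] at hr
  simp only [Nat.cast_zero] at hr
  have : (0 : ℤ) ≤ ((D.P.map Prod.snd).sum : ℕ) := by positivity
  linarith

/-- soundness, parametrised by a provider of the parity conclusions (S4) for the leaves -/
theorem depthBound_of_valid' (C : BnCCert) (hv : C.valid = true)
    (hpar : ∀ lf ∈ C.leaves, ∀ D : Design, D.A1 →
      (∀ sd : Side, ∀ c' ∈ suppSide D sd, admType C.h (allBounds C.vars lf) sd (typeOf c') = true) → ParityOK C lf D) :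
    DepthBound C.h C.B C.rmin ((C.h : ℤ) - 1) := by
  intro D hA h1 h4 _hμ hB hr c hc f
  by_contra hlt
  have hh := (hA c hc f).1
  have ha0 := (hA c hc f).2
  unfold Letter.height at hh
  unfold Letter.colevel at hlt
  have hfloor : (c f).a = 0 := by
    push Not at hlt
    have habs : 0 ≤ |(c f).x| + |(c f).y| := by positivity
    omega
  have hleaves : C.leaves.all (fun lf => checkLeaf C lf) = true := by
    have hv' := hv
    unfold BnCCert.valid at hv'
    simp only [Bool.and_eq_true] at hv'
    exact hv'.1.2
  have hsides : D.suppN ≠ [] ∧ D.suppP ≠ [] := by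
    rcases List.mem_append.mp hc with hcN | hcP
    · obtain ⟨x, hx, _⟩ := h4.2 c hcN
      exact ⟨List.ne_nil_of_mem hcN, List.ne_nil_of_mem hx⟩
    · obtain ⟨y, hy, _⟩ := h4.1 c hcP
      exact ⟨List.ne_nil_of_mem hy, List.ne_nil_of_mem hcP⟩
  obtain ⟨lf, hlf, hreg, hadm⟩ := region_cover C hv D hA h4 c hc f hfloor
  have hchk : checkLeaf C lf = true := List.all_eq_true.mp hleaves lf hlf
  exact leaf_sound C lf hchk D h1 hB hr hsides.1 hsides.2 hreg hadm (hpar lf hlf D h1 hadm)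

/-- a certificate is PARITY-FREE if no record claims `thr = 2` (no block laws are relied on) -/
def BnCCert.parityFree (C : BnCCert) : Bool := C.leaves.all fun lf => lf.recs.all fun r => decide (r.thr ≤ 1)

/-- **SOUNDNESS FOR PARITY-FREE CERTIFICATES** (the v2–v4 sorry-free fragment, kept; superseded by `depthBound_of_valid` in §7). -/
theorem depthBound_of_valid_parityFree (C : BnCCert) (hv : C.valid = true) (hpf : C.parityFree = true) :
    DepthBound C.h C.B C.rmin ((C.h : ℤ) - 1) := by
  refine depthBound_of_valid' C hv fun lf hlf D _ _ e he k _ h2 _ => ?_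
  exfalso
  unfold BnCCert.parityFree at hpf
  have hr := List.all_eq_true.mp (List.all_eq_true.mp hpf lf hlf) e.2 (List.of_mem_zip he).2
  rw [decide_eq_true_eq] at hr
  omega

/-- `HeightTower.FloorFree`, restated by shape (crux workfiles with unbuilt oleans are not imported): no admissible design uses a floor letter. -/
def FloorFreeH (h : ℤ) (B : ℕ) (rmin : ℤ) : Prop :=
  ∀ D : Design, D.OnAlphabet h → D.A1 → D.A4 → D.mu ≠ 0 → D.copies ≤ B → rmin ≤ D.rank →
    ∀ c ∈ D.suppN ++ D.suppP, ∀ f : Fin 4, 0 < (c f).a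

/-! ## §6 Extension points
* E1 — CELL LEAVES: TYPED in v3 (`Func.cell`, `RowSpec`, `admCells`, `checkPt`; soundness `row_balance` ∕ `Gc_balance` ∕ `mem_admCells` ∕
  `checkPt_sound` proved).
* E1b — ORBIT FOLDING.  In FORMAT v1 every REGION is `G`-stable (`G = ((ℤ∕4)⁴ ⋊ S₄) ⋊ ℤ∕2`, `|G| = 12 288`, `B4FloorSymmetry`): variables are
  slot-symmetric counts of rotation∕conjugation-blind shapes, so there are no leaf orbits to fold; the group acts on the POINTWISE DOMAIN inside
  each leaf.  CLASS LEVEL (`S₄` on ordered types) — TYPED AND PROVED in v6 (§3 `admTypesSorted`, §(S5) `clsPt_all`; factor `m⁴ ∕ C(m+3, 4)`,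
  13.3× at `h = 6`, 21.3× at `h = 14`).  CELL LEVEL (not typed): the phases `(ℤ∕4)⁴` act freely on the letters of a non-hub shape, so a cell
  functional that is phase-invariant needs checking on ONE sector representative per slot (factor `4^{#non-hub slots} ≤ 256`); an optimal
  Farkas certificate of a `G`-stable LP may be taken `G`-invariant (average it), and averaging kills every row of non-trivial phase character,
  so the typed form would be: rows restricted to words of trivial character under the declared subgroup (`#e ≡ #ē` slotwise-weighted), checker
  enumerates sector representatives, transport lemma = `DepthBoundA4.cellCoef_rotCell_phase` + rotation-invariance of `typeOf`.  Until then a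
  symmetric cell certificate is simply expanded (same soundness, up to 256× the checking time; XBASE-LOCK's universe is ALREADY a phase
  quotient by its anchor normalisation, so nothing is lost there).
* E2 — the `μ`-branch of `RingFiveEmpty` (`QP0 ∕ QN0`: all N-letters on the axes ⇒ `μ = 0` by a `G`-sandwich) as a third closing rule.
* E3 — = E1b at class level: DONE (v6).  Laws, parity certificates and cell leaves keep the ordered enumerations (slot-specific data).
* (P) KERNEL PRICE (v6): literal alphabet tables `admP0Table` ∕ `admN0Table` (verified once, `admP0Table_ok` ∕ `admN0Table_ok`).  Emitters should
  likewise write every `Stat` as a LITERAL shape list (the checker compares `vars[0]` with `floorStat h` once; a symbolic `floorStat h` inside a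
  record would be re-evaluated at every count — cheap now through the table, free as a literal).
-/

/-! ## §4b (S3) BLOCK-LAW SOUNDNESS — proved (v4).  A law is VERIFIED numerically by `checkLaw` on every admissible type, so its
soundness is linear algebra over the 27 (A1).1 rows «`e` at the active slot, an e-free filling elsewhere»: no law GENERATOR is needed
in the kernel. -/

/-- the e-free symbol of a passive filling -/
def filSym : Fil → Sym
  | Fil.one => Sym.one
  | Fil.h => Sym.h
  | Fil.pt => Sym.pt

theorem filSym_ne_e (φ : Fil) : filSym φ ≠ Sym.e := by cases φ <;> decide
theorem filSym_ne_ebar (φ : Fil) : filSym φ ≠ Sym.ebar := by cases φ <;> decide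

/-- the e-free coefficient of a filling symbol is the class datum `v = (1, a, n)` of the letter's shape -/
theorem coef_filSym (φ : Fil) (ℓ : Letter) : (filSym φ).coef ℓ = ((φ.v (shapeOf ℓ) : ℤ) : GaussianInt) := by
  cases φ with
  | one => simp [filSym, Sym.coef, Fil.v]
  | h => simp [filSym, Sym.coef, Fil.v, shapeOf]
  | pt => simp [filSym, Sym.coef, Fil.v, shapeOf_n]

/-- the (A1).1 word of a law filling: `e` at the active slot `f`, the filling at the passive slots in increasing slot order (as `passive`) -/
def lawWord (f : Fin 4) (φ : Fil × Fil × Fil) : Word :=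
  if f = 0 then ![Sym.e, filSym φ.1, filSym φ.2.1, filSym φ.2.2]
  else if f = 1 then ![filSym φ.1, Sym.e, filSym φ.2.1, filSym φ.2.2]
  else if f = 2 then ![filSym φ.1, filSym φ.2.1, Sym.e, filSym φ.2.2]
  else ![filSym φ.1, filSym φ.2.1, filSym φ.2.2, Sym.e]

/-- the value `V_φ(τ) = v(τ₁)[φ₁] · v(τ₂)[φ₂] · v(τ₃)[φ₃]` of a filling on a passive triple -/
def filVal (φ : Fil × Fil × Fil) (τ : Shape × Shape × Shape) : ℤ := φ.1.v τ.1 * φ.2.1.v τ.2.1 * φ.2.2.v τ.2.2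

theorem coef_e (ℓ : Letter) : Sym.e.coef ℓ = star ℓ.beta := rfl

theorem cellCoef_lawWord (f : Fin 4) (φ : Fil × Fil × Fil) (c : Cell) :
    cellCoef c (lawWord f φ) = star (c f).beta * ((filVal φ (passive f (typeOf c)) : ℤ) : GaussianInt) := by
  fin_cases f <;> simp [cellCoef, Fin.prod_univ_four, lawWord, passive, typeOf, filVal, coef_filSym, coef_e] <;> ring

theorem lawWord_mixed (f : Fin 4) (φ : Fil × Fil × Fil) :
    ¬ (lawWord f φ).efree ∧ lawWord f φ ≠ Word.eeee ∧ lawWord f φ ≠ Word.EEEE := by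
  fin_cases f
  · exact ⟨fun h => by simpa [lawWord, Sym.efree] using h 0,
      fun h => filSym_ne_e φ.1 (by simpa [lawWord, Word.eeee] using congrFun h 1),
      fun h => filSym_ne_ebar φ.1 (by simpa [lawWord, Word.EEEE] using congrFun h 1)⟩
  · exact ⟨fun h => by simpa [lawWord, Sym.efree] using h 1,
      fun h => filSym_ne_e φ.1 (by simpa [lawWord, Word.eeee] using congrFun h 0),
      fun h => filSym_ne_ebar φ.1 (by simpa [lawWord, Word.EEEE] using congrFun h 0)⟩
  · exact ⟨fun h => by simpa [lawWord, Sym.efree] using h 2,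
      fun h => filSym_ne_e φ.1 (by simpa [lawWord, Word.eeee] using congrFun h 0),
      fun h => filSym_ne_ebar φ.1 (by simpa [lawWord, Word.EEEE] using congrFun h 0)⟩
  · exact ⟨fun h => by simpa [lawWord, Sym.efree] using h 3,
      fun h => filSym_ne_e φ.1 (by simpa [lawWord, Word.eeee] using congrFun h 0),
      fun h => filSym_ne_ebar φ.1 (by simpa [lawWord, Word.EEEE] using congrFun h 0)⟩

/-- each law word is an (A1).1 row: balanced between the sides -/
theorem lawWord_balance (D : Design) (h1 : D.A1) (f : Fin 4) (φ : Fil × Fil × Fil) :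
    linG D.N (fun c => cellCoef c (lawWord f φ)) = linG D.P (fun c => cellCoef c (lawWord f φ)) := by
  obtain ⟨hne, h1e, h2e⟩ := lawWord_mixed f φ
  have hT := h1.1 _ hne h1e h2e
  rw [T_eq_linG] at hT
  exact sub_eq_zero.mp hT

theorem linG_add' (L : List (Cell × ℕ)) (φ ψ : Cell → GaussianInt) :
    linG L (fun c => φ c + ψ c) = linG L φ + linG L ψ := by
  induction L with
  | nil => simp [linG]
  | cons a t ih => rw [linG_cons, linG_cons, linG_cons, ih]; ring

theorem linG_const_mul (L : List (Cell × ℕ)) (k : GaussianInt) (φ : Cell → GaussianInt) :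
    linG L (fun c => k * φ c) = k * linG L φ := by
  induction L with
  | nil => simp [linG]
  | cons a t ih => rw [linG_cons, linG_cons, ih]; ring

/-- `linG` only sees cells of positive multiplicity -/
theorem linG_congr_pos (L : List (Cell × ℕ)) (φ ψ : Cell → GaussianInt) (h : ∀ cm ∈ L, 0 < cm.2 → φ cm.1 = ψ cm.1) :
    linG L φ = linG L ψ := by
  induction L with
  | nil => simp [linG]
  | cons a t ih =>
    rw [linG_cons, linG_cons, ih fun cm hcm hpos => h cm (List.mem_cons_of_mem _ hcm) hpos]
    rcases Nat.eq_zero_or_pos a.2 with h0 | hpos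
    · simp [h0]
    · rw [h a List.mem_cons_self hpos]

/-- the law functional `Σ_φ y_φ · row(lawWord f φ)` on a cell -/
def lawG (f : Fin 4) (yφs : List (ℤ × (Fil × Fil × Fil))) (c : Cell) : GaussianInt :=
  (yφs.map fun p => (p.1 : GaussianInt) * cellCoef c (lawWord f p.2)).sum

theorem lawG_balance (D : Design) (h1 : D.A1) (f : Fin 4) (yφs : List (ℤ × (Fil × Fil × Fil))) :
    linG D.N (lawG f yφs) = linG D.P (lawG f yφs) := by
  induction yφs with
  | nil =>
    have h0 : lawG f [] = fun _ => (0 : GaussianInt) * 0 := by funext c; simp [lawG]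
    rw [h0, linG_const_mul, linG_const_mul, zero_mul, zero_mul]
  | cons p t ih =>
    have hfun : lawG f (p :: t) = fun c => (p.1 : GaussianInt) * cellCoef c (lawWord f p.2) + lawG f t c := by
      funext c; simp [lawG]
    rw [hfun, linG_add', linG_add', linG_const_mul, linG_const_mul, ih, lawWord_balance D h1 f p.2]

theorem lawG_eq (f : Fin 4) (yφs : List (ℤ × (Fil × Fil × Fil))) (c : Cell) :
    lawG f yφs c = star (c f).beta * (((yφs.map fun p => p.1 * filVal p.2 (passive f (typeOf c))).sum : ℤ) : GaussianInt) := by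
  induction yφs with
  | nil => simp [lawG]
  | cons p t ih =>
    simp only [lawG, List.map_cons, List.sum_cons] at ih ⊢
    rw [ih, cellCoef_lawWord]; push_cast; ring

theorem lawSum_eq (y : List ℤ) (τ : Shape × Shape × Shape) :
    lawSum y τ = ((y.zip fillings).map fun p => p.1 * filVal p.2 τ).sum := rfl

/-- the active letter of a hub-active type has `β = 0` -/
theorem beta_eq_zero_of_isHub (ℓ : Letter) (h : (shapeOf ℓ).isHub = true) : ℓ.beta = 0 := by
  simp only [shapeOf, Shape.isHub, decide_eq_true_eq] at h
  obtain ⟨hp, _⟩ := h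
  have hx : |ℓ.x| ≤ 0 := hp ▸ le_max_left _ _
  have hy : |ℓ.y| ≤ 0 := hp ▸ le_max_right _ _
  have hx0 : ℓ.x = 0 := abs_nonpos_iff.mp hx
  have hy0 : ℓ.y = 0 := abs_nonpos_iff.mp hy
  ext
  · simp [Letter.beta, hx0]
  · simp [Letter.beta, hy0]

/-- **(S3) BLOCK-LAW SOUNDNESS**: a law valid in the region annihilates, via the 27 (A1).1 rows «`e` at the active slot, e-free
elsewhere», every `β̄`-sum except the targeted ones: `Σ_{c ∈ U_N} m_c · β̄(c_f) − Σ_{c ∈ U_P} m_c · β̄(c_f) = 0` in `ℤ[i]`. -/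
theorem law_sound (C : BnCCert) (lf : Leaf) (law : Law) (hlaw : checkLaw C.h (allBounds C.vars lf) law = true)
    (D : Design) (h1 : D.A1)
    (hadm : ∀ sd : Side, ∀ c' ∈ suppSide D sd, admType C.h (allBounds C.vars lf) sd (typeOf c') = true) :
    linG D.N (fun c => if law.inU C.h (allBounds C.vars lf) Side.N (typeOf c) then star (c law.slot).beta else 0)
      - linG D.P (fun c => if law.inU C.h (allBounds C.vars lf) Side.P (typeOf c) then star (c law.slot).beta else 0) = 0 := by
  generalize allBounds C.vars lf = bs at *
  simp only [checkLaw, Bool.and_eq_true, decide_eq_true_eq, List.all_eq_true, Bool.or_eq_true] at hlaw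
  obtain ⟨⟨⟨hK, _⟩, hall⟩, _⟩ := hlaw
  -- pointwise: on a supported cell the law functional is `K` times the `U`-indicator functional
  have hpt : ∀ sd, ∀ c ∈ suppSide D sd, lawG law.slot (law.y.zip fillings) c =
      (law.K : GaussianInt) * (if law.inU C.h bs sd (typeOf c) then star (c law.slot).beta else 0) := by
    intro sd c hc
    have ha := hadm sd c hc
    have hmem : sd ∈ [Side.N, Side.P] := by cases sd <;> simp
    rw [lawG_eq, ← lawSum_eq]
    rcases hall sd hmem (typeOf c) (mem_admTypes ha) with hhub | hsum
    · have hb : (c law.slot).beta = 0 := beta_eq_zero_of_isHub _ hhub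
      simp only [Law.inU, hhub, hb, star_zero, zero_mul]
      simp
    · cases hh : (typeOf c law.slot).isHub
      · cases hel : law.targ.elem (passive law.slot (typeOf c))
        · rw [hel] at hsum
          simp only [Bool.false_eq_true, if_false] at hsum
          rw [hsum]
          simp only [Law.inU, ha, hh, hel]
          simp
        · rw [hel] at hsum
          simp only [if_true] at hsum
          rw [hsum]
          simp only [Law.inU, ha, hh, hel]
          simp [mul_comm]
      · have hb : (c law.slot).beta = 0 := beta_eq_zero_of_isHub _ hh
        simp only [Law.inU, hh, hb, star_zero, zero_mul]
        simp
  have hN := linG_congr_pos D.N (lawG law.slot (law.y.zip fillings))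
    (fun c => (law.K : GaussianInt) * (if law.inU C.h bs Side.N (typeOf c) then star (c law.slot).beta else 0))
    fun cm hcm hpos => hpt Side.N cm.1 ((mem_suppN_iff D cm.1).mpr ⟨cm.2, hcm, hpos⟩)
  have hP := linG_congr_pos D.P (lawG law.slot (law.y.zip fillings))
    (fun c => (law.K : GaussianInt) * (if law.inU C.h bs Side.P (typeOf c) then star (c law.slot).beta else 0))
    fun cm hcm hpos => hpt Side.P cm.1 ((mem_suppP_iff D cm.1).mpr ⟨cm.2, hcm, hpos⟩)
  rw [linG_const_mul] at hN hP
  have hbal := lawG_balance D h1 law.slot (law.y.zip fillings)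
  have hKne : (law.K : GaussianInt) ≠ 0 := fun h => hK (by have := congrArg Zsqrtd.re h; simpa using this)
  have hzero : (law.K : GaussianInt) *
      (linG D.N (fun c => if law.inU C.h bs Side.N (typeOf c) then star (c law.slot).beta else 0)
        - linG D.P (fun c => if law.inU C.h bs Side.P (typeOf c) then star (c law.slot).beta else 0)) = 0 := by
    rw [mul_sub, ← hN, ← hP, hbal, sub_self]
  rcases mul_eq_zero.mp hzero with h0 | h0
  · exact absurd h0 hKne
  · exact h0

/-! ## §4c (S4) PARITY EXTRACTION — proved (v5).  Pure-ℤ «halving» induction on the common 2-adic valuation of `x² + y²` over the list of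
`(±m·[c ∈ U], x, −y)` read off the real and imaginary parts of the (S3) identity; the `twoVal` specification; the Bool-XOR parity of
`checkParity`'s fold; assembly by linearity of `linZ`. -/

theorem even_sq_add_sq_iff (x y : ℤ) : Even (x ^ 2 + y ^ 2) ↔ Even (x + y) := by
  simp [Int.even_add, Int.even_pow]

/-- indicator of a Bool as an integer -/
def indB (b : Bool) : ℤ := if b then 1 else 0

/-- XOR-fold parity: the indicator of `foldl (· != f ·) b₀ par` has the parity of `[b₀] + Σ_{j ∈ par} [f j]` -/
theorem xor_parity {ι : Type} (f : ι → Bool) : ∀ (par : List ι) (b₀ : Bool),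
    2 ∣ indB (par.foldl (fun acc j => acc != f j) b₀) + indB b₀ + (par.map fun j => indB (f j)).sum
  | [], b₀ => by cases b₀ <;> simp [indB]
  | j :: t, b₀ => by
    have ih := xor_parity f t (b₀ != f j)
    simp only [List.foldl_cons, List.map_cons, List.sum_cons]
    have hstep : 2 ∣ indB b₀ + indB (f j) - indB (b₀ != f j) := by
      cases b₀ <;> cases f j <;> simp [indB]
    have key : indB (List.foldl (fun acc j => acc != f j) (b₀ != f j) t) + indB b₀ + (indB (f j) + (t.map fun j => indB (f j)).sum)
        = (indB (List.foldl (fun acc j => acc != f j) (b₀ != f j) t) + indB (b₀ != f j) + (t.map fun j => indB (f j)).sum)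
          + (indB b₀ + indB (f j) - indB (b₀ != f j)) := by ring
    rw [key]
    exact dvd_add ih hstep

/-- the halving map `(n, x, y) ↦ (n, (x+y)/2, (y−x)/2)` (division by `1 + i` up to a unit, on integer pairs) -/
def half (e : ℤ × ℤ × ℤ) : ℤ × ℤ × ℤ := (e.1, (e.2.1 + e.2.2) / 2, (e.2.2 - e.2.1) / 2)

theorem sum_fst_half (L : List (ℤ × ℤ × ℤ)) : ((L.map half).map fun e => e.1).sum = (L.map fun e => e.1).sum := by
  simp [List.map_map, Function.comp_def, half]

theorem two_mul_sum_x_half (L : List (ℤ × ℤ × ℤ)) (hev : ∀ e ∈ L, e.1 = 0 ∨ 2 ∣ e.2.1 + e.2.2) :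
    2 * ((L.map half).map fun e => e.1 * e.2.1).sum = (L.map fun e => e.1 * e.2.1).sum + (L.map fun e => e.1 * e.2.2).sum := by
  induction L with
  | nil => simp
  | cons e t ih =>
    have ih' := ih fun e' he' => hev e' (List.mem_cons_of_mem _ he')
    have he : 2 * (e.1 * ((e.2.1 + e.2.2) / 2)) = e.1 * e.2.1 + e.1 * e.2.2 := by
      rcases hev e List.mem_cons_self with h0 | hd
      · simp [h0]
      · rw [mul_left_comm, Int.mul_ediv_cancel' hd, mul_add]
    simp only [List.map_cons, List.sum_cons, List.map_map, Function.comp_def, half] at ih' ⊢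
    linarith

theorem two_mul_sum_y_half (L : List (ℤ × ℤ × ℤ)) (hev : ∀ e ∈ L, e.1 = 0 ∨ 2 ∣ e.2.1 + e.2.2) :
    2 * ((L.map half).map fun e => e.1 * e.2.2).sum = (L.map fun e => e.1 * e.2.2).sum - (L.map fun e => e.1 * e.2.1).sum := by
  induction L with
  | nil => simp
  | cons e t ih =>
    have ih' := ih fun e' he' => hev e' (List.mem_cons_of_mem _ he')
    have he : 2 * (e.1 * ((e.2.2 - e.2.1) / 2)) = e.1 * e.2.2 - e.1 * e.2.1 := by
      rcases hev e List.mem_cons_self with h0 | hd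
      · simp [h0]
      · have hd' : 2 ∣ e.2.2 - e.2.1 := by omega
        rw [mul_left_comm, Int.mul_ediv_cancel' hd', mul_sub]
    simp only [List.map_cons, List.sum_cons, List.map_map, Function.comp_def, half] at ih' ⊢
    linarith

theorem half_norm {x y : ℤ} {v : ℕ} {o : ℤ} (hxy : 2 ∣ x + y) (ho : x ^ 2 + y ^ 2 = 2 ^ (v + 1) * o) :
    ((x + y) / 2) ^ 2 + ((y - x) / 2) ^ 2 = 2 ^ v * o := by
  obtain ⟨a, ha⟩ := hxy
  have hb2 : 2 ∣ y - x := by omega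
  obtain ⟨b, hb⟩ := hb2
  rw [ha, hb, Int.mul_ediv_cancel_left _ two_ne_zero, Int.mul_ediv_cancel_left _ two_ne_zero]
  have hx : x = a - b := by omega
  have hy : y = a + b := by omega
  rw [hx, hy] at ho
  have h2 : 2 * (a ^ 2 + b ^ 2) = 2 * (2 ^ v * o) := by
    calc 2 * (a ^ 2 + b ^ 2) = (a - b) ^ 2 + (a + b) ^ 2 := by ring
      _ = 2 ^ (v + 1) * o := ho
      _ = 2 * (2 ^ v * o) := by ring
  exact mul_left_cancel₀ two_ne_zero h2

/-- the pure-ℤ parity core: integer weights `n` on Gaussian integers `x + iy` of ONE common valuation `v₂(x² + y²) = v` (weight-0 entries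
exempt) with `Σ n·x = Σ n·y = 0` have even total weight -/
theorem parity_core : ∀ (v : ℕ) (L : List (ℤ × ℤ × ℤ)),
    (∀ e ∈ L, e.1 = 0 ∨ ∃ o : ℤ, e.2.1 ^ 2 + e.2.2 ^ 2 = 2 ^ v * o ∧ Odd o) →
    (L.map fun e => e.1 * e.2.1).sum = 0 → (L.map fun e => e.1 * e.2.2).sum = 0 →
    2 ∣ (L.map fun e => e.1).sum
  | 0, L, hL, hx, hy => by
    have key : 2 ∣ (L.map fun e => e.1).sum + ((L.map fun e => e.1 * e.2.1).sum + (L.map fun e => e.1 * e.2.2).sum) := by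
      clear hx hy
      induction L with
      | nil => simp
      | cons e t ih =>
        simp only [List.map_cons, List.sum_cons]
        have ih' := ih fun e' he' => hL e' (List.mem_cons_of_mem _ he')
        have he : 2 ∣ e.1 + (e.1 * e.2.1 + e.1 * e.2.2) := by
          rcases hL e List.mem_cons_self with h0 | ⟨o, ho, hoo⟩
          · simp [h0]
          · rw [pow_zero, one_mul] at ho
            have hodd : Odd (e.2.1 + e.2.2) := by
              have hne : ¬ Even (e.2.1 ^ 2 + e.2.2 ^ 2) := by rw [ho]; exact Int.not_even_iff_odd.mpr hoo
              rw [even_sq_add_sq_iff] at hne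
              exact Int.not_even_iff_odd.mp hne
            obtain ⟨k, hk⟩ := hodd
            have h2 : e.1 + (e.1 * e.2.1 + e.1 * e.2.2) = 2 * (e.1 * (k + 1)) := by
              calc e.1 + (e.1 * e.2.1 + e.1 * e.2.2) = e.1 * (e.2.1 + e.2.2 + 1) := by ring
                _ = e.1 * (2 * k + 1 + 1) := by rw [hk]
                _ = 2 * (e.1 * (k + 1)) := by ring
            rw [h2]; exact dvd_mul_right 2 _
        have hsum := dvd_add he ih'
        have e1 : e.1 + (t.map fun e => e.1).sum
              + ((e.1 * e.2.1 + (t.map fun e => e.1 * e.2.1).sum) + (e.1 * e.2.2 + (t.map fun e => e.1 * e.2.2).sum))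
            = (e.1 + (e.1 * e.2.1 + e.1 * e.2.2))
              + ((t.map fun e => e.1).sum + ((t.map fun e => e.1 * e.2.1).sum + (t.map fun e => e.1 * e.2.2).sum)) := by ring
        rw [e1]; exact hsum
    rwa [hx, hy, add_zero, add_zero] at key
  | v + 1, L, hL, hx, hy => by
    have hev : ∀ e ∈ L, e.1 = 0 ∨ 2 ∣ e.2.1 + e.2.2 := by
      intro e he
      rcases hL e he with h0 | ⟨o, ho, _⟩
      · exact Or.inl h0
      · right
        have hE : Even (e.2.1 ^ 2 + e.2.2 ^ 2) := ⟨2 ^ v * o, by rw [ho]; ring⟩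
        exact even_iff_two_dvd.mp ((even_sq_add_sq_iff _ _).mp hE)
    have hL' : ∀ e' ∈ L.map half, e'.1 = 0 ∨ ∃ o : ℤ, e'.2.1 ^ 2 + e'.2.2 ^ 2 = 2 ^ v * o ∧ Odd o := by
      intro e' he'
      obtain ⟨e, he, rfl⟩ := List.mem_map.mp he'
      rcases hL e he with h0 | ⟨o, ho, hoo⟩
      · exact Or.inl h0
      · rcases hev e he with h0 | hd
        · exact Or.inl h0
        · exact Or.inr ⟨o, half_norm hd ho, hoo⟩
    have hx' : ((L.map half).map fun e => e.1 * e.2.1).sum = 0 := by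
      have h2 := two_mul_sum_x_half L hev
      rw [hx, hy, add_zero] at h2
      rcases mul_eq_zero.mp h2 with h | h
      · exact absurd h two_ne_zero
      · exact h
    have hy' : ((L.map half).map fun e => e.1 * e.2.2).sum = 0 := by
      have h2 := two_mul_sum_y_half L hev
      rw [hx, hy, sub_zero] at h2
      rcases mul_eq_zero.mp h2 with h | h
      · exact absurd h two_ne_zero
      · exact h
    have h1 := parity_core v (L.map half) hL' hx' hy'
    rwa [sum_fst_half] at h1

/-- specification of the fuelled 2-adic valuation -/
theorem twoVal_spec : ∀ (fuel n : ℕ), 0 < n → n ≤ fuel → ∃ o : ℕ, n = 2 ^ twoVal fuel n * o ∧ o % 2 = 1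
  | 0, n, h0, hf => by omega
  | fuel + 1, n, h0, hf => by
    by_cases hc : n = 0 ∨ n % 2 = 1
    · refine ⟨n, ?_, by omega⟩
      simp [twoVal, hc]
    · obtain ⟨o, ho, hoo⟩ := twoVal_spec fuel (n / 2) (by omega) (by omega)
      refine ⟨o, ?_, hoo⟩
      have h2 : twoVal (fuel + 1) n = twoVal fuel (n / 2) + 1 := by
        simp [twoVal, hc]
      rw [h2, pow_succ]
      calc n = 2 * (n / 2) := by omega
        _ = 2 * (2 ^ twoVal fuel (n / 2) * o) := by rw [← ho]
        _ = 2 ^ twoVal fuel (n / 2) * 2 * o := by ring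

/-- a non-hub letter's `x² + y²` is `2^{val2} · odd` -/
theorem val2_spec (ℓ : Letter) (hh : (shapeOf ℓ).isHub = false) :
    ∃ o : ℤ, ℓ.x ^ 2 + ℓ.y ^ 2 = 2 ^ (shapeOf ℓ).val2 * o ∧ Odd o := by
  have hb : (shapeOf ℓ).bnorm = ℓ.x ^ 2 + ℓ.y ^ 2 := by simp [shapeOf, Shape.bnorm, sq_max_add_sq_min]
  have hxy : ¬ (ℓ.x = 0 ∧ ℓ.y = 0) := by
    rintro ⟨hx, hy⟩
    simp [shapeOf, Shape.isHub, hx, hy] at hh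
  have hpos : 0 < ℓ.x ^ 2 + ℓ.y ^ 2 := by
    by_cases hx : ℓ.x = 0
    · have hy : ℓ.y ≠ 0 := fun hy => hxy ⟨hx, hy⟩
      have := mul_self_pos.mpr hy
      nlinarith [sq_nonneg ℓ.x]
    · have := mul_self_pos.mpr hx
      nlinarith [sq_nonneg ℓ.y]
  obtain ⟨o, ho, hoo⟩ := twoVal_spec (ℓ.x ^ 2 + ℓ.y ^ 2).toNat (ℓ.x ^ 2 + ℓ.y ^ 2).toNat (by omega) le_rfl
  refine ⟨o, ?_, Int.odd_iff.mpr (by omega)⟩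
  have hv : (shapeOf ℓ).val2 = twoVal (ℓ.x ^ 2 + ℓ.y ^ 2).toNat (ℓ.x ^ 2 + ℓ.y ^ 2).toNat := by
    simp only [Shape.val2, hb]
  rw [hv]
  have hcast : ((ℓ.x ^ 2 + ℓ.y ^ 2).toNat : ℤ) = ℓ.x ^ 2 + ℓ.y ^ 2 := Int.toNat_of_nonneg hpos.le
  generalize twoVal (ℓ.x ^ 2 + ℓ.y ^ 2).toNat (ℓ.x ^ 2 + ℓ.y ^ 2).toNat = t at ho ⊢
  have hc := congrArg (fun n : ℕ => (n : ℤ)) ho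
  push_cast at hc
  rw [hcast] at hc
  exact hc

/-- the entry `(s·m·[c ∈ U], ξ c, η c)` of a design row -/
def mkE (s : ℤ) (φ ξ η : Cell → ℤ) (cm : Cell × ℕ) : ℤ × ℤ × ℤ := (s * ((cm.2 : ℤ) * φ cm.1), ξ cm.1, η cm.1)

theorem sum_mkE_fst (L : List (Cell × ℕ)) (s : ℤ) (φ ξ η : Cell → ℤ) :
    ((L.map (mkE s φ ξ η)).map fun e => e.1).sum = s * linZ L φ := by
  induction L with
  | nil => simp [linZ]
  | cons a t ih =>
    rw [linZ_cons]
    simp only [List.map_cons, List.sum_cons, List.map_map] at ih ⊢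
    rw [ih]; simp only [mkE]; ring

theorem sum_mkE_x (L : List (Cell × ℕ)) (s : ℤ) (φ ξ η : Cell → ℤ) :
    ((L.map (mkE s φ ξ η)).map fun e => e.1 * e.2.1).sum = s * linZ L (fun c => φ c * ξ c) := by
  induction L with
  | nil => simp [linZ]
  | cons a t ih =>
    rw [linZ_cons]
    simp only [List.map_cons, List.sum_cons, List.map_map] at ih ⊢
    rw [ih]; simp only [mkE]; ring

theorem sum_mkE_y (L : List (Cell × ℕ)) (s : ℤ) (φ ξ η : Cell → ℤ) :
    ((L.map (mkE s φ ξ η)).map fun e => e.1 * e.2.2).sum = s * linZ L (fun c => φ c * η c) := by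
  induction L with
  | nil => simp [linZ]
  | cons a t ih =>
    rw [linZ_cons]
    simp only [List.map_cons, List.sum_cons, List.map_map] at ih ⊢
    rw [ih]; simp only [mkE]; ring

theorem re_ite_star_beta (b : Bool) (ℓ : Letter) :
    (if b then star ℓ.beta else (0 : GaussianInt)).re = (if b then (1 : ℤ) else 0) * ℓ.x := by
  cases b <;> simp [Letter.beta]

theorem im_ite_star_beta (b : Bool) (ℓ : Letter) :
    (if b then star ℓ.beta else (0 : GaussianInt)).im = (if b then (1 : ℤ) else 0) * (-ℓ.y) := by
  cases b <;> simp [Letter.beta]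

/-- `linZ` of pointwise-even values (on positive-multiplicity entries) is even -/
theorem linZ_dvd_of_pos (L : List (Cell × ℕ)) (φ : Cell → ℤ) (h : ∀ cm ∈ L, 0 < cm.2 → 2 ∣ φ cm.1) : 2 ∣ linZ L φ := by
  induction L with
  | nil => simp [linZ]
  | cons a t ih =>
    rw [linZ_cons]
    refine dvd_add ?_ (ih fun cm hcm hpos => h cm (List.mem_cons_of_mem _ hcm) hpos)
    rcases Nat.eq_zero_or_pos a.2 with h0 | hpos
    · simp [h0]
    · exact dvd_mul_of_dvd_right (h a List.mem_cons_self hpos) _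

theorem sum_map_sub' (par : List ℕ) (a b : ℕ → ℤ) :
    (par.map fun j => a j - b j).sum = (par.map a).sum - (par.map b).sum := by
  induction par with
  | nil => simp
  | cons j t ih => simp only [List.map_cons, List.sum_cons, ih]; ring

/-- (S3) ⇒ per-law evenness: `Σ_{U_N} m − Σ_{U_P} m` is even (common `(1+i)`-adic valuation of the active `β̄` over `U` = the `val2`
conjunct of `checkLaw`, then `parity_core`) -/
theorem law_even (C : BnCCert) (lf : Leaf) (law : Law) (hlaw : checkLaw C.h (allBounds C.vars lf) law = true)
    (D : Design) (h1 : D.A1)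
    (hadm : ∀ sd : Side, ∀ c' ∈ suppSide D sd, admType C.h (allBounds C.vars lf) sd (typeOf c') = true) :
    2 ∣ linZ D.N (fun c => if law.inU C.h (allBounds C.vars lf) Side.N (typeOf c) then 1 else 0)
        - linZ D.P (fun c => if law.inU C.h (allBounds C.vars lf) Side.P (typeOf c) then 1 else 0) := by
  have hS := law_sound C lf law hlaw D h1 hadm
  generalize allBounds C.vars lf = bs at *
  simp only [checkLaw, Bool.and_eq_true, decide_eq_true_eq, List.all_eq_true, Bool.or_eq_true] at hlaw
  obtain ⟨_, hval⟩ := hlaw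
  -- the common valuation
  generalize hW : ([Side.N, Side.P].flatMap fun sd =>
      ((admTypes C.h bs sd).filter fun t => law.inU C.h bs sd t).map fun t => (t law.slot).val2).headD 0 = W at hval
  -- indicator functions and the entry list
  let φN : Cell → ℤ := fun c => if law.inU C.h bs Side.N (typeOf c) then 1 else 0
  let φP : Cell → ℤ := fun c => if law.inU C.h bs Side.P (typeOf c) then 1 else 0
  let ξ : Cell → ℤ := fun c => (c law.slot).x
  let η : Cell → ℤ := fun c => -(c law.slot).y
  let L : List (ℤ × ℤ × ℤ) := D.N.map (mkE 1 φN ξ η) ++ D.P.map (mkE (-1) φP ξ η)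
  have hAB := sub_eq_zero.mp hS
  have hre := congrArg Zsqrtd.re hAB
  have him := congrArg Zsqrtd.im hAB
  rw [re_linG, re_linG] at hre
  rw [im_linG, im_linG] at him
  simp only [re_ite_star_beta] at hre
  simp only [im_ite_star_beta] at him
  have hx : (L.map fun e => e.1 * e.2.1).sum = 0 := by
    simp only [L, List.map_append, List.sum_append, sum_mkE_x]
    simp only [φN, φP, ξ]
    linarith
  have hy : (L.map fun e => e.1 * e.2.2).sum = 0 := by
    simp only [L, List.map_append, List.sum_append, sum_mkE_y]
    simp only [φN, φP, η]
    linarith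
  -- the valuation hypothesis, entry by entry
  have hval2 : ∀ sd : Side, ∀ c ∈ suppSide D sd, law.inU C.h bs sd (typeOf c) = true →
      ∃ o : ℤ, (ξ c) ^ 2 + (η c) ^ 2 = 2 ^ W * o ∧ Odd o := by
    intro sd c hc hin
    have ha := hadm sd c hc
    have hin' := hin
    simp only [Law.inU, Bool.and_eq_true, Bool.not_eq_true'] at hin'
    obtain ⟨⟨_, hhub⟩, _⟩ := hin'
    obtain ⟨o, ho, hoo⟩ := val2_spec (c law.slot) hhub
    have hmem : (typeOf c law.slot).val2 ∈ ([Side.N, Side.P].flatMap fun sd =>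
        ((admTypes C.h bs sd).filter fun t => law.inU C.h bs sd t).map fun t => (t law.slot).val2) := by
      refine List.mem_flatMap.mpr ⟨sd, by cases sd <;> simp, ?_⟩
      exact List.mem_map.mpr ⟨typeOf c, List.mem_filter.mpr ⟨mem_admTypes ha, hin⟩, rfl⟩
    have hw := hval _ hmem
    refine ⟨o, ?_, hoo⟩
    simp only [ξ, η, neg_sq]
    rw [ho]
    exact congrArg (fun t => (2 : ℤ) ^ t * o) hw
  have hL : ∀ e ∈ L, e.1 = 0 ∨ ∃ o : ℤ, e.2.1 ^ 2 + e.2.2 ^ 2 = 2 ^ W * o ∧ Odd o := by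
    intro e he
    rcases List.mem_append.mp he with hN | hP
    · obtain ⟨cm, hcm, rfl⟩ := List.mem_map.mp hN
      rcases Nat.eq_zero_or_pos cm.2 with h0 | hpos
      · left; simp [mkE, h0]
      · cases hin : law.inU C.h bs Side.N (typeOf cm.1)
        · left; simp [mkE, φN, hin]
        · right
          exact hval2 Side.N cm.1 ((mem_suppN_iff D cm.1).mpr ⟨cm.2, hcm, hpos⟩) hin
    · obtain ⟨cm, hcm, rfl⟩ := List.mem_map.mp hP
      rcases Nat.eq_zero_or_pos cm.2 with h0 | hpos
      · left; simp [mkE, h0]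
      · cases hin : law.inU C.h bs Side.P (typeOf cm.1)
        · left; simp [mkE, φP, hin]
        · right
          exact hval2 Side.P cm.1 ((mem_suppP_iff D cm.1).mpr ⟨cm.2, hcm, hpos⟩) hin
  have hcore := parity_core W L hL hx hy
  simp only [L, List.map_append, List.sum_append, sum_mkE_fst] at hcore
  simp only [φN, φP] at hcore
  have e1 : linZ D.N (fun c => if law.inU C.h bs Side.N (typeOf c) then 1 else 0)
      - linZ D.P (fun c => if law.inU C.h bs Side.P (typeOf c) then 1 else 0)
      = 1 * linZ D.N (fun c => if law.inU C.h bs Side.N (typeOf c) then 1 else 0)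
        + (-1) * linZ D.P (fun c => if law.inU C.h bs Side.P (typeOf c) then 1 else 0) := by ring
  rw [e1]; exact hcore

/-- **(S4) PARITY EXTRACTION**: a checked parity entry makes the mass of the attaining set of its variable EVEN. -/
theorem parity_even (C : BnCCert) (lf : Leaf) (v : Var) (k : ℕ) (par : List ℕ)
    (he : checkParity C.h (allBounds C.vars lf) lf.laws v k par = true) (D : Design) (h1 : D.A1)
    (hadm : ∀ sd : Side, ∀ c' ∈ suppSide D sd, admType C.h (allBounds C.vars lf) sd (typeOf c') = true) :
    2 ∣ linZ D.N (fun c => if attains v k Side.N (typeOf c) then 1 else 0)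
        + linZ D.P (fun c => if attains v k Side.P (typeOf c) then 1 else 0) := by
  have hlaws : ∀ j ∈ par, ∃ law, lf.laws[j]? = some law ∧ checkLaw C.h (allBounds C.vars lf) law = true := by
    have he1 := he
    simp only [checkParity, Bool.and_eq_true, List.all_eq_true] at he1
    intro j hj
    have hj' := he1.1 j hj
    cases hlj : lf.laws[j]? with
    | none => simp [hlj] at hj'
    | some law => exact ⟨law, rfl, by simpa [hlj] using hj'⟩
  -- per-law evenness (uses `allBounds C.vars lf` literally), then generalize the bounds
  have hEven : ∀ j ∈ par, ∀ law, lf.laws[j]? = some law →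
      2 ∣ linZ D.N (fun c => if law.inU C.h (allBounds C.vars lf) Side.N (typeOf c) then 1 else 0)
          - linZ D.P (fun c => if law.inU C.h (allBounds C.vars lf) Side.P (typeOf c) then 1 else 0) := by
    intro j hj law hlj
    obtain ⟨law', hlj', hcl⟩ := hlaws j hj
    rw [hlj] at hlj'
    cases hlj'
    exact law_even C lf law hcl D h1 hadm
  generalize allBounds C.vars lf = bs at *
  -- the law sets as a function of the index
  let g : Side → STuple → ℕ → Bool := fun sd t j => match lf.laws[j]? with | some law => law.inU C.h bs sd t | none => false
  have hG : ∀ j ∈ par, 2 ∣ linZ D.N (fun c => indB (g Side.N (typeOf c) j)) - linZ D.P (fun c => indB (g Side.P (typeOf c) j)) := by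
    intro j hj
    obtain ⟨law, hlj, _⟩ := hlaws j hj
    have h2 := hEven j hj law hlj
    have hfN : (fun c => indB (g Side.N (typeOf c) j)) = fun c => if law.inU C.h bs Side.N (typeOf c) then 1 else 0 := by
      funext c; simp only [g, hlj, indB]
    have hfP : (fun c => indB (g Side.P (typeOf c) j)) = fun c => if law.inU C.h bs Side.P (typeOf c) then 1 else 0 := by
      funext c; simp only [g, hlj, indB]
    rw [hfN, hfP]; exact h2
  -- pointwise XOR parity on admissible types
  have hpt : ∀ sd, ∀ c ∈ suppSide D sd,
      2 ∣ indB (attains v k sd (typeOf c)) + (par.map fun j => indB (g sd (typeOf c) j)).sum := by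
    intro sd c hc
    have ha := hadm sd c hc
    have he2 := he
    simp only [checkParity, Bool.and_eq_true, List.all_eq_true, decide_eq_true_eq] at he2
    have hfold := he2.2 sd (by cases sd <;> simp) (typeOf c) (mem_admTypes ha)
    have hfeq : par.foldl (fun acc j => match lf.laws[j]? with | some law => acc != law.inU C.h bs sd (typeOf c) | none => acc) false
        = par.foldl (fun acc j => acc != g sd (typeOf c) j) false := by
      congr 1
      funext acc j
      simp only [g]
      cases lf.laws[j]? <;> simp
    have hx := xor_parity (g sd (typeOf c)) par false
    rw [← hfeq, ← hfold] at hx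
    simpa [indB] using hx
  have hN := linZ_dvd_of_pos D.N (fun c => indB (attains v k Side.N (typeOf c)) + (par.map fun j => indB (g Side.N (typeOf c) j)).sum)
    fun cm hcm hpos => hpt Side.N cm.1 ((mem_suppN_iff D cm.1).mpr ⟨cm.2, hcm, hpos⟩)
  have hP := linZ_dvd_of_pos D.P (fun c => indB (attains v k Side.P (typeOf c)) + (par.map fun j => indB (g Side.P (typeOf c) j)).sum)
    fun cm hcm hpos => hpt Side.P cm.1 ((mem_suppP_iff D cm.1).mpr ⟨cm.2, hcm, hpos⟩)
  rw [linZ_add, linZ_sum_map] at hN hP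
  have hsum : 2 ∣ (par.map fun j => linZ D.N (fun c => indB (g Side.N (typeOf c) j))).sum
      - (par.map fun j => linZ D.P (fun c => indB (g Side.P (typeOf c) j))).sum := by
    rw [← sum_map_sub']
    exact List.dvd_sum fun x hx => by
      obtain ⟨j, hj, rfl⟩ := List.mem_map.mp hx
      exact hG j hj
  have hiN : linZ D.N (fun c => indB (attains v k Side.N (typeOf c))) = linZ D.N (fun c => if attains v k Side.N (typeOf c) then 1 else 0) := rfl
  have hiP : linZ D.P (fun c => indB (attains v k Side.P (typeOf c))) = linZ D.P (fun c => if attains v k Side.P (typeOf c) then 1 else 0) := rfl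
  rw [← hiN, ← hiP]
  omega

/-! ## §7 SOUNDNESS — the end-to-end theorems (sorry-free since v5) -/

/-- **SOUNDNESS (depth form).** A valid certificate proves the depth bound `c₀ = h − 1` at height `h`, i.e. no floor letter
— sorry-free since v5: (S1)(S2)(S3)(S4)(S5) are all theorems of this file. -/
theorem depthBound_of_valid (C : BnCCert) (hv : C.valid = true) : DepthBound C.h C.B C.rmin ((C.h : ℤ) - 1) :=
  depthBound_of_valid' C hv fun lf _ D h1 hadm e _ k _ _ he => parity_even C lf e.1 k e.2.par he D h1 hadm

/-- **SOUNDNESS (floor form):** `valid ⇒ FloorFree h B rmin`. -/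
theorem floorFree_of_valid (C : BnCCert) (hv : C.valid = true) : FloorFreeH C.h C.B C.rmin := by
  intro D hA h1 h4 hμ hB hr c hc f
  have hcl := depthBound_of_valid C hv D hA h1 h4 hμ hB hr c hc f
  have hh := (hA c hc f).1
  unfold Letter.height at hh
  unfold Letter.colevel at hcl
  linarith

end Summit.HodgeConjecture.HodgeConjecture.Cruxes.BlochSeedDiscOne.BnCCert
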